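import Literature.AlgebraicGeometry.MovasatiVillaflor2018.LinearCyclePeriods
import Literature.AlgebraicGeometry.Villaflor2022.HodgeLocusCodimensionGaps
import Literature.AlgebraicGeometry.Villaflor2022.TwoLinearCyclesColonIdeals
import Literature.AlgebraicGeometry.DuqueFrancoVillaflor2025.JoinHilbertFunction
import Literature.AlgebraicGeometry.HodgeTheory.FermatJacobianRingGorenstein
import Literature.RingTheory.HilbertSamuel.PolynomialRing
import Literature.LinearAlgebra.Matrix.RankMinors
import Mathlib.Data.Finsupp.MonomialOrder
import Mathlib.LinearAlgebra.Matrix.Block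
import HarnessLib

/-!
# Movasati's lower bound for the rank of the Fermat period matrix `[p_{i+j}]` (GMCD Theorem 2, Propositions 7–8)

H. Movasati, *Gauss–Manin connection in disguise: Noether–Lefschetz and Hodge loci*, Asian J. Math. 21 (2017)
463–482 = arXiv:1411.1766 [Movasati2017GMCD]. Verbatim from the held text (chunks p0004, p0010):

> **Theorem 2.** Let `V` be the parameter space of smooth hypersurfaces of degree `d` in `ℙ^{n+1}` and let
> `0 ∈ V` be the parameter of the Fermat variety. Assume that `d ≥ 2 + 4/n`. There is a Zariski open
> neighborhood `U` of `0 ∈ V` such that all the components of the Hodge locus […] intersecting `U` have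
> codimension `≥ C(n/2+d, d) − (n/2+1)²`. The lower bound is obtained by the locus `H` of hypersurfaces
> containing a linear projective space `ℙ^{n/2} ⊂ ℙ^{n+1}`.
>
> [§1, after Theorem 2:] Let `I_N := {(i_0,…,i_{n+1}) ∈ ℕ₀^{n+2} | 0 ≤ i_e ≤ d−2, i_0 + ⋯ + i_{n+1} = N}` […]
> consider independent variables `x_i` indexed by `i ∈ I_{(n/2+1)d−n−2}`. For any other `i` which is not in the
> set `I_{(n/2+1)d−n−2}`, `x_i` by definition is zero. Let `M := [x_{i+j}]` be a matrix whose rows and columns are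
> indexed by `i ∈ I_{(n/2)d−n−2}` and `j ∈ I_d`, respectively […]. The matrix `M` is obtained by IVHS for the
> Fermat point.
>
> **§3.5 Proof of Theorem 2.** […] We get the following Olympiad problem:
> **Proposition 7.** If `rank([x_{i+j}]) < C(n/2+d, d) − (n/2+1)²` then all `x_i`, `i ∈ I_{(n/2+1)d−(n+2)}` are
> zero. *Proof.* Take any additive ordering for `ℕ₀^{n+2}`, that is, `i < j` if and only if `i + k < j + k`
> […]. We use decreasing induction on `k` […]. We collect all `k = i_e + j_e`, `i_e ∈ I_{(n/2)d−n−2}`, `j_e ∈ I_d`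
> […] and order them according to the decreasing order of `i_e`'s […]. We find a `f × f`-submatrix of
> `[x_{i+j}]` which is lower triangular and in its diagonal we have only `x_k`. Therefore, its determinant is
> `x_k^f`. Now our proposition follows from an even more elementary problem.
> **Proposition 8.** For any `k ∈ I_{(n/2+1)d−(n+2)}` we have
> `#{(i,j) ∈ I_{(n/2)d−(n+2)} × I_d | k = i + j} ≥ C(n/2+d, d) − (n/2+1)²`. *Proof.* […] the lower bound […]
> is obtained by elements `k` such that `n/2+1` number of `k_e`'s are zero and the rest (exactly the next half)
> is `d−2`. […] assume that `0 < k_0 < k_1 < d−2`. We prove that `#A_{(k_0,k_1,⋯)} ≥ #A_{(k_0−1,k_1+1,⋯)}` […]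
> we define a map `A_{(k_0−1,k_1+1,⋯)} → A_{(k_0,k_1,⋯)}` and prove that it is injective […].
> In Proposition 7 the number in the right hand side […] is the biggest one with such a property. […] Such
> numbers are the periods of the projective space `ℙ^{n/2}` inside the Fermat variety.

R. Villaflor Loyola, *Small codimension components of the Hodge locus containing the Fermat variety*,
Commun. Contemp. Math. 24 (2022) 2150053 = arXiv:2001.01019 [Villaflorloyola2021], which re-proves the bound
(chunks p0004, p0009, p0010):

> [§1, (cotatangent):] In particular Movasati proved that if `0 ∈ T` denotes the Fermat variety, then
> `codim_{T_0T} T_0V_λ ≥ C(n/2+d, d) − (n/2+1)²`, for all local Hodge loci `V_λ` passing trough the Fermat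
> variety. In fact he proves this bound without assuming `λ` is an integral class and so the bound above holds
> for any `λ ∈ H^{n/2,n/2}(X)_prim` (we prove this fact again in Proposition 4.1).
>
> **Proposition 3.3.** Let `x^α` be any monomial. For every `d > 0` let `S^d_α := {x^β ∈ ℂ[x]_d : x^β | x^α}`.
> Then, for any `i ≠ j` such that `0 < α_i ≤ α_j`, `#S^d_{α'} ≤ #S^d_α` where `α'_k := α_k` for `k ≠ i,j`,
> `α'_i := α_i − 1` and `α'_j := α_j + 1`. […] As a consequence, for every `x^α | (x_0 ⋯ x_{n+1})^{d−2}` of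
> `deg(x^α) = σ = (d−2)(n/2+1)` we have `#S^d_α ≥ C(n/2+d, d) − (n/2+1)²` […]. *Proof.* Consider the map
> `f : S^d_{α'} → S^d_α` given by `f(x^{β'}) := x^{β'}·(x_i/x_j)` if `β'_j > 0`, `x^{β'}·(x_j/x_i)^{β'_i}` if
> `β'_j = 0`. This map is clearly injective.
>
> **Proposition 4.1.** Let `X = {F = 0}` be a smooth hypersurface of even dimension `n` and degree
> `d ≥ 2 + 4/n`. Let `λ ∈ F^{n/2}H^n_dR(X)_prim ∖ F^{n/2+1}` and `σ := (d−2)(n/2+1)`. If for some monomial order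
> there exists `x^α ∈ ℂ[x]_σ ∖ ⟨LT(J^{F,λ})⟩_σ` such that `x^α | x_0^{d−2} ⋯ x_{n+1}^{d−2}`, then
> (des1) `dim_ℂ R^{F,λ}_d ≥ C(n/2+d, d) − (n/2+1)²`.

Villaflor's §2 (Definition 2.1, Propositions 2.1–2.2) identifies `J^{F,λ}` with the graded annihilator of the
period functional `ℓ_λ` on `ℂ[x]_σ` (tree `Kloosterman2025.annIdeal`), `R^{F,λ} = ℂ[x]/J^{F,λ}`, and, at the
Fermat point, with the colon ideal `(J^F : P_λ)` of the monomial Jacobian ideal `J^F = (x_e^{d−1})`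
(Duque Franco–Villaflor Def. 2.2); Movasati's Theorem 6 of [Movasati2016Periods] / Villaflor's Prop. 2.1
identify `ker [p_{i+j}]`, resp. `(J^{F,λ})_d`, with the Zariski tangent space `T_0V_λ`. Those transcendental
identifications are NOT formalised; everything below is the algebra/combinatorics, over an arbitrary field.

## What this file PROVES (0 facts, 0 sorry)

In the vocabulary of the tree (`Movasati2016.indexSet m d N` = `I_N`, `Movasati2016.periodMatrix m d N M p`
= `[p_{i+j}]_{I_N × I_M}`, `Kloosterman2023.ciHilbert`, `Kloosterman2025.annIdeal`,
`HodgeTheory.fermatSocleFunctional`), for `m` variables, `d ≥ 3`, `σ = M + N = (k+1)(d−2)` (Fermat `n`-fold: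
`m = n+2`, `k = n/2`, `M = d`, `N = (n/2)d−n−2`):

* **Proposition 8 / Villaflor Prop. 3.3** — `divSet κ M` (= `A_κ` read through `j`, = `S^M_κ`);
  `card_divSet_shift_le` (the printed injection `f`); `ciHilbert_le_card_divSet`: for every `κ ∈ [0,d−2]^m` with
  `|κ| = (k+1)(d−2)`, `#A_κ(M) ≥ ciHilbert((d−1)^{k+1})(M)` (the count at the concentrated shape, a box count:
  `card_divSet_indicator`), for EVERY column degree `M`; at `M = d`: `= C(k+d, d) − (k+1)²`
  (`ciHilbert_replicate_eq_choose_sub_sq`).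
* **Proposition 7** — `card_divSet_le_rank_periodMatrix`: for a period vector `p` vanishing outside the box and the
  largest `κ ∈ I_{M+N}` (any `MonomialOrder`) with `p_κ ≠ 0`, the minor of `[p_{i+j}]` on columns `j ≤ κ`, rows
  `κ − j` is lower triangular with diagonal `p_κ`, so `rank [p_{i+j}] ≥ #A_κ(M)` (tree
  `LinearAlgebra.Matrix.card_le_rank_of_det_submatrix_ne_zero`).
* **Theorem 2 (tangent form)** — `ciHilbert_le_rank_periodMatrix`, `choose_sub_sq_le_rank_periodMatrix`,
  `movasati_rank_periodMatrix_ge` (`(n,d)`-form: `n` even, `n + 2 ≤ (n/2)d`, every admissible non-zero `p`: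
  `rank [p_{i+j}] ≥ C(n/2+d,d) − (n/2+1)²`), `movasatiBound_le_rank_periodMatrix` (with the tree's
  `Villaflor2022.movasatiBound`), `movasati_rank_periodMatrix_comb_ge` (every `K`-combination of linear cycles with
  non-zero period vector, tree `MovasatiVillaflor2018.combPeriod`), and **sharpness** `isLeast_rank_periodMatrix`: the
  bound is the least rank over all admissible period vectors, attained by the periods of a linear `ℙ^{n/2}` (tree
  `MovasatiVillaflor2018.rank_periodMatrix_linearCyclePeriod`).
* **Equality case of the count (Villaflor Prop. 3.3, strictness "if `α_j ≤ d ≤ deg(x^α) − α_i`")** —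
  `card_divSet_shift_lt`; `ciHilbert_lt_card_divSet` (a box vector with SOME exponent strictly between `0` and `d−2`
  has `#A_κ(M) > ciHilbert((d−1)^{k+1})(M)` whenever `d − 3 ≤ M ≤ σ − 1`); `card_divSet_eq_ciHilbert_iff` (equality iff
  every exponent is `0` or `d−2`); hence **Prop. 4.1's (igualdad1)**: `leadingExponent_mem_of_rank_eq`,
  `leadingExponent_mem_of_rank_eq_movasatiBound` — if `rank [p_{i+j}]` EQUALS the bound (`M = d` needs `d ≥ 2 + 6/n`,
  Remark 4.1) then for every monomial order the leading box exponent of `p` is `(d−2)·𝟙_E`, `#E = n/2+1`.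
* **Villaflor (cotatangent) / Prop. 4.1 (des1)** — `ciHilbert_le_hilbert_annIdeal`, `choose_sub_sq_le_hilbert_annIdeal`:
  for every non-zero functional `ℓ` concentrated in degree `σ` and killing `J^F`,
  `HF_{Ann ℓ}(M) ≥ ciHilbert((d−1)^{k+1})(M)` (`M ≤ σ`), `HF_{Ann ℓ}(d) ≥ C(k+d,d) − (k+1)²` (`d ≤ σ`, i.e.
  `d ≥ 2 + 4/n`); colon form at the Fermat point `ciHilbert_le_hilbert_fermat_colon`,
  `choose_sub_sq_le_hilbert_fermat_colon` (`dim S_M − dim (J^F : P)_M ≥ …` for every form `P ∉ J^F` of the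
  complementary degree).
* **Villaflor Prop. 4.1, second half** — `hilbert_annIdeal_one_eq_of_hilbert_eq`: if `HF_{Ann ℓ}(d)` EQUALS
  `C(k+d,d) − (k+1)²` and `d + 1 ≤ σ` (`d ≥ 2 + 6/n`), then `HF_{Ann ℓ}(1) = k + 1`; for `m = 2k + 2` variables
  `finrank_annIdeal_one_of_hilbert_eq`: `dim (Ann ℓ)_1 = k + 1` — "there exist `L_1,…,L_{n/2+1} ∈ J^{F,λ}_1` linearly
  independent" (via the socle standard monomial, Macaulay's count `finrank_idealDegree_eq_card` of the tree, the
  complete-intersection shape of `⟨LT(J^{F,λ})⟩_{≥ d}` and duality `HF(1) = HF(σ−1)`); helpers `card_box_one`,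
  `ciHilbert_replicate_one_and_sub_one`, `hilbert_annIdeal_eq_card_standard`.
* **The second gap (Villaflor Prop. 3.3, last part; the tangent core of Thm. 1.3)** — `card_divSet_peel` (one-variable
  recursion of the count), `card_divSet_preFinal` (the shape `(d−2)·𝟙_E + (d−3)e_j + e_i`, `#E = k`, counts
  `ciHilbert(2, d−2, (d−1)^k)` = the `(1,…,1,2)` complete-intersection Hilbert function; at `M = d` the tree's
  `ciLocusCodim (1^k, 2) d` = `secondGapBound (2k) d`, `ciHilbert_preFinal_eq_ciLocusCodim`), `exists_preFinal_card_le` /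
  `ciHilbert_preFinal_le_card_divSet` (a NON-concentrated box vector dominates a pre-final shape:
  `#A_κ(M) ≥ ciHilbert(2, d−2, (d−1)^k)(M)`), hence `ciHilbert_preFinal_le_rank_periodMatrix` /
  `ciLocusCodim_le_rank_periodMatrix_of_not_concentrated` (rank form: leading box exponent not concentrated ⇒
  `rank ≥` second bound) and, by Villaflor's own route through the socle standard monomial `x^α` of `Ann ℓ`
  (`exists_standard_socle`, `card_divSet_le_hilbert_annIdeal_of_notMem`: divisors of a standard monomial are standard),
  `ciHilbert_preFinal_le_hilbert_annIdeal`: "(igualdad1) does not hold ⇒ `codim ≥ C(n/2+d,d) + C(n/2+d−1,d−1) −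
  (3n²/8 + 9n/4 + 2)`" at the level of `HF_{J^{F,λ}}`.
* **The Fermat case of the generalised Green–Otwinowska bound** — `fermat_jacobianRankLowerBound`: for
  `F = Σ_{i<2p+2} x_i^d`, `d ≥ 3`, `p ≥ 1`, `d ∈ K^×`, and every form `P` of degree `(p+1)(d−2)` outside the
  Jacobian ideal `(∂_j F)`: `dim{G ∈ S_d : G P ∈ (∂_j F)} + (C(d+p,p) − (p+1)²) ≤ C(d+2p+1, 2p+1) = dim S_d` — the
  shape of the route crux `JacobianRankLowerBound` (`Summits/HodgeConjecture/HodgeConjecture/Theses/ShortHodgeVectors.lean`,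
  "known … Fermat F (Movasati 2017)") specialised to the Fermat polynomial.

Deviation from the printed proofs: none in substance. "Any additive ordering" is Mathlib's `MonomialOrder`
(`degLex` is used to instantiate); Villaflor's Gröbner-degeneration step (Prop. 3.1: `HF(I) = HF(LT I)`) is not
needed because Movasati's triangular-minor argument bounds the rank directly; for the equality case, the printed
criterion makes the LAST shift of the concentration process strict (it moves `1 ↦ 0`, `d−3 ↦ d−2`), which is where
`d ≥ 2 + 6/n` enters; the second half of Prop. 4.1 follows the printed Gröbner argument (any monomial order; the
tree's `leadingExponents` / `finrank_idealDegree_eq_card` supply Prop. 3.1); for the second gap the same chain of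
shifts is used (it passes through a pre-final shape, whose count is peeled variable by variable). NOT formalised here:
Villaflor's Theorem 1.1 / Prop. 4.2 (the linear forms cut a `ℙ^{n/2}` INSIDE `X_0` — needs the period computations of
[VillaPCIAC]), the equality case of the second gap and the `CI(1,…,1,2)` conclusion of Thm. 1.3, and Thm. 1.2.

HONEST FRAMING (cell pub-hlocus): certified instances and evidence bearing on the general Hodge conjecture; no claim.

## References
* H. Movasati, Asian J. Math. 21 (2017) 463–482, Thm. 2, §1, §3.5 Props. 7–8. [Movasati2017GMCD]
* R. Villaflor Loyola, Commun. Contemp. Math. 24 (2022) 2150053, (cota), (cotatangent), Def. 2.1, Props. 2.1, 2.2,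
  3.3, 4.1. [Villaflorloyola2021]
* H. Movasati, arXiv:1602.06607, Def. 1, Thm. 6. [Movasati2016Periods]
* H. Movasati, R. Villaflor Loyola, Pure Appl. Math. Q. 14 (2018), Thm. 1, Prop. 1. [MovasatiVillaflor2018]
* J. Duque Franco, R. Villaflor Loyola, arXiv:2312.17222, Def. 2.2, Rem. 7.1. [DuqueFrancoVillaflor2025Join]
-/

noncomputable section

namespace Literature.AlgebraicGeometry.Movasati2017

open Finset

section Combinatorics

variable {τ : Type*} [Fintype τ] [DecidableEq τ]

/-- `A_κ(M) = {j : τ → ℕ | j ≤ κ, |j| = M}` — the degree-`M` monomials dividing `x^κ` (Villaflor's `S^M_κ`;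
Movasati's set `{(i,j) ∈ I_N × I_M : i + j = κ}` read through `j`). [cite: Movasati2017GMCD, §3.5 Proposition 8]
[cite: Villaflorloyola2021, Proposition 3.3] -/
def divSet (κ : τ → ℕ) (M : ℕ) : Finset (τ → ℕ) :=
  (Fintype.piFinset fun e => Finset.range (κ e + 1)).filter fun j => ∑ e, j e = M

/-- Membership in `A_κ(M)`. [cite: Villaflorloyola2021, Proposition 3.3] -/
theorem mem_divSet {κ : τ → ℕ} {M : ℕ} {j : τ → ℕ} :
    j ∈ divSet κ M ↔ (∀ e, j e ≤ κ e) ∧ ∑ e, j e = M := by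
  rw [divSet, Finset.mem_filter, Fintype.mem_piFinset]
  simp only [Finset.mem_range, Nat.lt_succ_iff]

/-- Bookkeeping: the total of a function changed at two places. [folklore] -/
private theorem sum_comp_update_update (φ : ℕ → ℕ) (g : τ → ℕ) {i j : τ} (hij : i ≠ j) (a b : ℕ) :
    ∑ e, φ (Function.update (Function.update g i a) j b e) + φ (g i) + φ (g j) =
      ∑ e, φ (g e) + φ a + φ b := by
  have h1 : (fun e => φ (Function.update (Function.update g i a) j b e)) =
      Function.update (Function.update (φ ∘ g) i (φ a)) j (φ b) := by
    rw [← Function.comp_update, ← Function.comp_update]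
    rfl
  have hj : j ∈ (Finset.univ : Finset τ) := Finset.mem_univ j
  have hi : i ∈ (Finset.univ : Finset τ) \ {j} := by simp [hij]
  rw [show ∑ e, φ (Function.update (Function.update g i a) j b e) =
      ∑ e, Function.update (Function.update (φ ∘ g) i (φ a)) j (φ b) e from by rw [← h1],
    Finset.sum_update_of_mem hj, Finset.sum_update_of_mem hi,
    show ∑ e, φ (g e) = ∑ e, (φ ∘ g) e from rfl,
    Finset.sum_eq_add_sum_sdiff_singleton_of_mem hj (φ ∘ g),
    Finset.sum_eq_add_sum_sdiff_singleton_of_mem hi (φ ∘ g)]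
  simp only [Function.comp_apply]
  ring

/-- The total of a function changed at two places. [folklore] -/
private theorem sum_update_update (g : τ → ℕ) {i j : τ} (hij : i ≠ j) (a b : ℕ) :
    ∑ e, Function.update (Function.update g i a) j b e + g i + g j = ∑ e, g e + a + b :=
  sum_comp_update_update id g hij a b

/-- The SHIFT `κ ↦ κ − e_i + e_j` (Movasati: `(k₀, k₁, …) ↦ (k₀ − 1, k₁ + 1, …)`; Villaflor: `α ↦ α'`).
[cite: Movasati2017GMCD, §3.5 Proposition 8] [cite: Villaflorloyola2021, Proposition 3.3] -/
def shift (κ : τ → ℕ) (i j : τ) : τ → ℕ :=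
  Function.update (Function.update κ i (κ i - 1)) j (κ j + 1)

omit [Fintype τ] in
/-- The shifted exponent at `j` is `κ_j + 1`. [cite: Villaflorloyola2021, Proposition 3.3] -/
@[simp] theorem shift_apply_right (κ : τ → ℕ) (i j : τ) : shift κ i j j = κ j + 1 := by
  simp [shift]

omit [Fintype τ] in
/-- The shifted exponent at `i` is `κ_i − 1`. [cite: Villaflorloyola2021, Proposition 3.3] -/
@[simp] theorem shift_apply_left (κ : τ → ℕ) {i j : τ} (hij : i ≠ j) : shift κ i j i = κ i - 1 := by
  simp [shift, hij]

omit [Fintype τ] in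
/-- The shift does not touch the other exponents. [cite: Villaflorloyola2021, Proposition 3.3] -/
theorem shift_apply_of_ne (κ : τ → ℕ) {i j e : τ} (hei : e ≠ i) (hej : e ≠ j) : shift κ i j e = κ e := by
  simp [shift, hei, hej]

/-- The shift preserves the total degree (when `κ_i ≥ 1`). [cite: Villaflorloyola2021, Proposition 3.3] -/
theorem sum_shift (κ : τ → ℕ) {i j : τ} (hij : i ≠ j) (hi : 0 < κ i) :
    ∑ e, shift κ i j e = ∑ e, κ e := by
  have h := sum_update_update κ hij (κ i - 1) (κ j + 1)
  rw [← shift] at h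
  omega

/-- **The shift does not increase the count** (Movasati (yekeshab) / Villaflor (tecdes)): for `i ≠ j` with
`0 < κ_i ≤ κ_j`, `#A_{κ − e_i + e_j}(M) ≤ #A_κ(M)`, by the explicit injection
`x^β ↦ x^β · x_i/x_j` (if `x_j | x^β`), `x^β ↦ x^β · (x_j/x_i)^{β_i}` (otherwise).
[cite: Movasati2017GMCD, §3.5 Proposition 8] [cite: Villaflorloyola2021, Proposition 3.3] -/
theorem card_divSet_shift_le (κ : τ → ℕ) {i j : τ} (hij : i ≠ j) (hi : 0 < κ i) (hle : κ i ≤ κ j)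
    (M : ℕ) : (divSet (shift κ i j) M).card ≤ (divSet κ M).card := by
  -- Villaflor's map `f`
  let f : (τ → ℕ) → (τ → ℕ) := fun β =>
    if 0 < β j then Function.update (Function.update β i (β i + 1)) j (β j - 1)
    else Function.update (Function.update β i 0) j (β i)
  have hf1 : ∀ β : τ → ℕ, 0 < β j →
      f β i = β i + 1 ∧ f β j = β j - 1 ∧ ∀ e, e ≠ i → e ≠ j → f β e = β e := by
    intro β hβ
    simp only [f, if_pos hβ]
    refine ⟨by simp [hij], by simp, fun e hei hej => by simp [hei, hej]⟩
  have hf2 : ∀ β : τ → ℕ, ¬ 0 < β j →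
      f β i = 0 ∧ f β j = β i ∧ ∀ e, e ≠ i → e ≠ j → f β e = β e := by
    intro β hβ
    simp only [f, if_neg hβ]
    refine ⟨by simp [hij], by simp, fun e hei hej => by simp [hei, hej]⟩
  have hsum1 : ∀ β : τ → ℕ, 0 < β j → ∑ e, f β e = ∑ e, β e := by
    intro β hβ
    have h := sum_update_update β hij (β i + 1) (β j - 1)
    simp only [f, if_pos hβ]
    omega
  have hsum2 : ∀ β : τ → ℕ, ¬ 0 < β j → ∑ e, f β e = ∑ e, β e := by
    intro β hβ
    have h := sum_update_update β hij 0 (β i)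
    simp only [f, if_neg hβ]
    omega
  refine Finset.card_le_card_of_injOn f (fun β hβ => ?_) (fun β hβ γ hγ hfg => ?_)
  · -- maps into `A_κ(M)`
    have hβ' := mem_divSet.mp (Finset.mem_coe.mp hβ)
    rw [Finset.mem_coe, mem_divSet]
    by_cases hj : 0 < β j
    · obtain ⟨h1, h2, h3⟩ := hf1 β hj
      refine ⟨fun e => ?_, by rw [hsum1 β hj, hβ'.2]⟩
      by_cases hei : e = i
      · subst hei; rw [h1]; have := hβ'.1 e; rw [shift_apply_left κ hij] at this; omega
      by_cases hej : e = j
      · subst hej; rw [h2]; have := hβ'.1 e; rw [shift_apply_right] at this; omega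
      rw [h3 e hei hej]; have := hβ'.1 e; rwa [shift_apply_of_ne κ hei hej] at this
    · obtain ⟨h1, h2, h3⟩ := hf2 β hj
      refine ⟨fun e => ?_, by rw [hsum2 β hj, hβ'.2]⟩
      by_cases hei : e = i
      · subst hei; rw [h1]; exact Nat.zero_le _
      by_cases hej : e = j
      · subst hej; rw [h2]; have := hβ'.1 i; rw [shift_apply_left κ hij] at this; omega
      rw [h3 e hei hej]; have := hβ'.1 e; rwa [shift_apply_of_ne κ hei hej] at this
  · -- injective on `A_{κ'}(M)`
    by_cases hbj : 0 < β j <;> by_cases hgj : 0 < γ j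
    · obtain ⟨h1, h2, h3⟩ := hf1 β hbj
      obtain ⟨h1', h2', h3'⟩ := hf1 γ hgj
      funext e
      by_cases hei : e = i
      · subst hei; have := congr_fun hfg e; rw [h1, h1'] at this; omega
      by_cases hej : e = j
      · subst hej; have := congr_fun hfg e; rw [h2, h2'] at this; omega
      have := congr_fun hfg e; rwa [h3 e hei hej, h3' e hei hej] at this
    · have := congr_fun hfg i
      rw [(hf1 β hbj).1, (hf2 γ hgj).1] at this
      omega
    · have := congr_fun hfg i
      rw [(hf2 β hbj).1, (hf1 γ hgj).1] at this
      omega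
    · obtain ⟨h1, h2, h3⟩ := hf2 β hbj
      obtain ⟨h1', h2', h3'⟩ := hf2 γ hgj
      funext e
      by_cases hei : e = i
      · subst hei; have := congr_fun hfg j; rw [h2, h2'] at this; exact this
      by_cases hej : e = j
      · subst hej; omega
      have := congr_fun hfg e; rwa [h3 e hei hej, h3' e hei hej] at this


/-- When some exponent lies strictly between `0` and the cap `c = d − 2` and the total is a multiple
`(k+1)c` of the cap, a count-non-increasing shift inside the box is available: there are `i ≠ j` with
`0 < κ_i ≤ κ_j < c` (Movasati: "For simplicity we can assume that `0 < k₀ < k₁ < d − 2`").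
[cite: Movasati2017GMCD, §3.5 Proposition 8 (proof)] -/
theorem exists_shift_pair {c k : ℕ} {κ : τ → ℕ} (hle : ∀ e, κ e ≤ c) (hsum : ∑ e, κ e = (k + 1) * c)
    (hmid : ∃ e, 0 < κ e ∧ κ e < c) :
    ∃ i j, i ≠ j ∧ 0 < κ i ∧ κ i ≤ κ j ∧ κ j < c := by
  classical
  set A : Finset τ := Finset.univ.filter fun e => 0 < κ e ∧ κ e < c with hA
  have hmemA : ∀ e, e ∈ A ↔ 0 < κ e ∧ κ e < c := fun e => by simp [hA]
  have hAne : A.Nonempty := by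
    obtain ⟨e, he⟩ := hmid
    exact ⟨e, (hmemA e).mpr he⟩
  -- the residues modulo `c`: `Σ_e κ_e ≡ Σ_{e ∈ A} κ_e (mod c)`
  have hmod : (∑ e ∈ A, κ e) % c = 0 := by
    have h1 : ∀ e, κ e % c = if e ∈ A then κ e else 0 := by
      intro e
      by_cases heA : e ∈ A
      · rw [if_pos heA]
        exact Nat.mod_eq_of_lt ((hmemA e).mp heA).2
      · rw [if_neg heA]
        have hne := (not_iff_not.mpr (hmemA e)).mp heA
        rcases Nat.eq_zero_or_pos (κ e) with h0 | hpos
        · rw [h0, Nat.zero_mod]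
        · have : κ e = c := by have := hle e; omega
          rw [this, Nat.mod_self]
    have h2 : (∑ e, κ e) % c = (∑ e ∈ A, κ e) % c := by
      rw [Finset.sum_nat_mod, Finset.sum_congr rfl fun e _ => h1 e, ← Finset.sum_filter,
        Finset.filter_mem_eq_inter, Finset.univ_inter]
    rw [← h2, hsum, Nat.mul_mod_left]
  -- hence `A` has at least two elements
  have hcard : 1 < A.card := by
    by_contra h
    have h1 : A.card = 1 := le_antisymm (not_lt.mp h) (Finset.card_pos.mpr hAne)
    obtain ⟨e₀, he₀⟩ := Finset.card_eq_one.mp h1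
    rw [he₀, Finset.sum_singleton] at hmod
    have hin : e₀ ∈ A := by rw [he₀]; exact Finset.mem_singleton_self _
    obtain ⟨hpos, hlt⟩ := (hmemA e₀).mp hin
    rw [Nat.mod_eq_of_lt hlt] at hmod
    omega
  obtain ⟨i, hiA, hmin⟩ := Finset.exists_min_image A κ hAne
  obtain ⟨a, haA, b, hbA, hab⟩ := Finset.one_lt_card.mp hcard
  obtain ⟨j, hjA, hji⟩ : ∃ j ∈ A, j ≠ i := by
    by_cases hai : a = i
    · exact ⟨b, hbA, fun h => hab (hai.trans h.symm)⟩
    · exact ⟨a, haA, hai⟩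
  exact ⟨i, j, hji.symm, ((hmemA i).mp hiA).1, hmin j hjA, ((hmemA j).mp hjA).2⟩

/-- The potential `μ(κ) = Σ_e κ_e (c − κ_e)` strictly decreases under the shift (so the shifting terminates).
[cite: Movasati2017GMCD, §3.5 Proposition 8 (proof: "repeating the same argument")] -/
theorem potential_shift_lt {c : ℕ} (κ : τ → ℕ) {i j : τ} (hij : i ≠ j) (hi : 0 < κ i) (hle : κ i ≤ κ j)
    (hj : κ j < c) :
    ∑ e, shift κ i j e * (c - shift κ i j e) < ∑ e, κ e * (c - κ e) := by
  have h := sum_comp_update_update (fun x => x * (c - x)) κ hij (κ i - 1) (κ j + 1)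
  rw [← shift] at h
  -- the two changed terms drop by `2(κ_j − κ_i) + 2`
  have key : (κ i - 1) * (c - (κ i - 1)) + (κ j + 1) * (c - (κ j + 1)) + 2 ≤
      κ i * (c - κ i) + κ j * (c - κ j) := by
    obtain ⟨x, hx⟩ : ∃ x, κ i = x + 1 := ⟨κ i - 1, by omega⟩
    obtain ⟨q, hq⟩ : ∃ q, c = κ j + 1 + q := ⟨c - (κ j + 1), by omega⟩
    rw [hx, hq]
    rw [hx] at hle
    have e1 : x + 1 - 1 = x := by omega
    have e2 : κ j + 1 + q - x = (κ j - x) + 1 + q := by omega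
    have e3 : κ j + 1 + q - (x + 1) = (κ j - x) + q := by omega
    have e4 : κ j + 1 + q - (κ j + 1) = q := by omega
    have e5 : κ j + 1 + q - κ j = q + 1 := by omega
    rw [e1, e2, e3, e4, e5]
    obtain ⟨y, hy⟩ : ∃ y, κ j = x + y := ⟨κ j - x, by omega⟩
    rw [hy, show x + y - x = y by omega]
    nlinarith
  omega

/-- **The concentrated shape realises the box count**: for `κ = c·𝟙_E`,
`#A_κ(M) = #{β ∈ [0,c]^E : |β| = M} = ciHilbert((c+1)^{#E})(M)` (the Hilbert function, in degree `M`, of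
`#E` variables with `(c+1)`-st powers killed; tree `Villaflor2022.card_box_eq_ciHilbert`).
[cite: Movasati2017GMCD, §3.5 Proposition 8] [cite: Villaflorloyola2021, Proposition 3.3] -/
theorem card_divSet_indicator (E : Finset τ) (c M : ℕ) :
    (divSet (fun e => if e ∈ E then c else 0) M).card =
      Kloosterman2023.ciHilbert (List.replicate E.card (c + 1)) M := by
  rw [← Villaflor2022.card_box_eq_ciHilbert E (Nat.le_add_left 1 c) M]
  refine Finset.card_nbij' (fun j => Finsupp.equivFunOnFinite.symm j) (fun β => ⇑β) (fun j hj => ?_)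
    (fun β hβ => ?_) (fun j _ => Finsupp.coe_equivFunOnFinite_symm j)
    (fun β _ => Finsupp.equivFunOnFinite_symm_coe β)
  · obtain ⟨hle, hsum⟩ := mem_divSet.mp (Finset.mem_coe.mp hj)
    rw [Finset.mem_coe, Villaflor2022.mem_box]
    simp only [Finsupp.coe_equivFunOnFinite_symm, Nat.add_sub_cancel]
    refine ⟨hsum, fun e => ?_, fun e he => ?_⟩
    · have := hle e
      split_ifs at this <;> omega
    · have := hle e
      rw [if_neg he] at this
      omega
  · obtain ⟨hsum, hle, hoff⟩ := Villaflor2022.mem_box.mp (Finset.mem_coe.mp hβ)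
    rw [Finset.mem_coe, mem_divSet]
    refine ⟨fun e => show β e ≤ _ from ?_, hsum⟩
    split_ifs with he
    · have := hle e; omega
    · rw [hoff e he]

/-- **Movasati's Proposition 8 / Villaflor's Proposition 3.3 (the count bound)**: for every exponent vector
`κ` in the box `[0, c]^τ` of total degree `(k+1)·c` (`c = d − 2`; for the Fermat `n`-fold, `k = n/2` and
`|κ| = σ = (n/2+1)(d−2)`), and every column degree `M`,
`#A_κ(M) ≥ ciHilbert((c+1)^{k+1})(M)` — the value at the shape with `k+1` entries `c` and the rest `0`
("the lower bound is obtained by elements `k` such that `n/2+1` of the `k_e`'s are zero and the rest is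
`d−2`"). [cite: Movasati2017GMCD, §3.5 Proposition 8] [cite: Villaflorloyola2021, Proposition 3.3] -/
theorem ciHilbert_le_card_divSet {c k : ℕ} (hc : 1 ≤ c) {κ : τ → ℕ} (hle : ∀ e, κ e ≤ c)
    (hsum : ∑ e, κ e = (k + 1) * c) (M : ℕ) :
    Kloosterman2023.ciHilbert (List.replicate (k + 1) (c + 1)) M ≤ (divSet κ M).card := by
  classical
  -- strong induction on the potential `μ(κ) = Σ κ_e (c − κ_e)`
  suffices h : ∀ (μ : ℕ) (κ : τ → ℕ), ∑ e, κ e * (c - κ e) = μ → (∀ e, κ e ≤ c) →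
      ∑ e, κ e = (k + 1) * c →
      Kloosterman2023.ciHilbert (List.replicate (k + 1) (c + 1)) M ≤ (divSet κ M).card from
    h _ κ rfl hle hsum
  intro μ
  induction μ using Nat.strong_induction_on with
  | _ μ ih =>
    intro κ hμ hle hsum
    by_cases hmid : ∃ e, 0 < κ e ∧ κ e < c
    · -- shift and recurse
      obtain ⟨i, j, hij, hi, hij', hj⟩ := exists_shift_pair hle hsum hmid
      have hlt := potential_shift_lt κ hij hi hij' hj
      rw [hμ] at hlt
      refine le_trans (ih _ hlt (shift κ i j) rfl (fun e => ?_) ?_) (card_divSet_shift_le κ hij hi hij' M)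
      · by_cases hei : e = i
        · subst hei; rw [shift_apply_left κ hij]; have := hle e; omega
        by_cases hej : e = j
        · subst hej; rw [shift_apply_right]; omega
        rw [shift_apply_of_ne κ hei hej]; exact hle e
      · rw [sum_shift κ hij hi, hsum]
    · -- every entry is `0` or `c`: the concentrated shape
      push Not at hmid
      set E : Finset τ := Finset.univ.filter fun e => κ e = c with hE
      have hκ : κ = fun e => if e ∈ E then c else 0 := by
        funext e
        by_cases he : e ∈ E
        · rw [if_pos he]; simpa [hE] using he
        · rw [if_neg he]
          have hne : κ e ≠ c := by simpa [hE] using he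
          have := hmid e
          have := hle e
          omega
      have hcardE : E.card = k + 1 := by
        have h1 : ∑ e, κ e = E.card * c := by
          conv_lhs => rw [hκ]
          rw [← Finset.sum_filter, Finset.filter_mem_eq_inter, Finset.univ_inter, Finset.sum_const,
            smul_eq_mul]
        rw [hsum] at h1
        exact (Nat.eq_of_mul_eq_mul_right hc h1).symm
      rw [hκ, card_divSet_indicator, hcardE]

/-- The closed form of the bound in the column degree `M = d` (`c + 1 = d − 1`, `d ≥ 3`):
`ciHilbert((d−1)^{k+1})(d) = C(k+d, d) − (k+1)²` — the number of degree-`d` monomials in `k+1` variables minus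
the `(k+1)²` with an exponent `≥ d − 1` (tree `DuqueFrancoVillaflor2025.linC_closed_form`).
[cite: Movasati2017GMCD, Theorem 2] [cite: Villaflorloyola2021, (cota)] -/
theorem ciHilbert_replicate_eq_choose_sub_sq (k : ℕ) {d : ℕ} (hd : 3 ≤ d) :
    Kloosterman2023.ciHilbert (List.replicate (k + 1) (d - 1)) d = (k + d).choose d - (k + 1) ^ 2 := by
  have h := DuqueFrancoVillaflor2025.linC_closed_form 0 k d hd
  rw [Kloosterman2023.linC, List.replicate_zero, List.nil_append] at h
  omega

end Combinatorics

/-! ## Proposition 7: the rank of `[p_{i+j}]` is at least `#A_κ(M)` for the leading exponent `κ` of `p` -/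

section Rank

open Movasati2016

variable {K : Type*} [Field K] {m d : ℕ}

/-- The sort key of an exponent vector in a monomial order ("Take any additive ordering for `ℕ₀^{n+2}`, that is,
`i < j` if and only if `i + k < j + k`"). [cite: Movasati2017GMCD, §3.5 Proposition 7 (proof)] -/
noncomputable def okey (mo : MonomialOrder (Fin m)) (i : Fin m → ℕ) : mo.syn :=
  mo.toSyn (Finsupp.equivFunOnFinite.symm i)

/-- The key is additive. [cite: Movasati2017GMCD, §3.5 Proposition 7 (proof)] -/
theorem okey_add (mo : MonomialOrder (Fin m)) (i j : Fin m → ℕ) :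
    okey mo (fun e => i e + j e) = okey mo i + okey mo j := by
  unfold okey
  rw [← map_add]
  exact congrArg _ (Finsupp.ext fun _ => rfl)

/-- The key is injective. [cite: Movasati2017GMCD, §3.5 Proposition 7 (proof)] -/
theorem okey_injective (mo : MonomialOrder (Fin m)) : Function.Injective (okey mo) :=
  mo.toSyn.injective.comp Finsupp.equivFunOnFinite.symm.injective

/-- Decoding a key. [cite: Movasati2017GMCD, §3.5 Proposition 7 (proof)] -/
theorem coe_toSyn_symm_okey (mo : MonomialOrder (Fin m)) (i : Fin m → ℕ) :
    ⇑(mo.toSyn.symm (okey mo i)) = i := by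
  simp [okey]

/-- **Movasati's Proposition 7 (the triangular minor).** Let `p` be a period vector which vanishes outside
Movasati's box (as the periods of the Fermat variety do: "for any other `i` which is not in the set `I`, `x_i`
by definition is zero"), and let `κ ∈ I_{M+N}` be the LARGEST exponent (for some monomial order) with
`p_κ ≠ 0`. Then the minor of `[p_{i+j}]_{I_N × I_M}` on the columns `j ∈ A_κ(M)` (`j ≤ κ`) and the rows
`κ − j` is lower triangular with diagonal `p_κ`, so `rank [p_{i+j}] ≥ #A_κ(M)` ("We find an `f × f`-submatrix
of `[x_{i+j}]` which is lower triangular and in its diagonal we have only `x_k`. Therefore, its determinant is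
`x_k^f`"). [cite: Movasati2017GMCD, §3.5 Proposition 7] -/
theorem card_divSet_le_rank_periodMatrix (mo : MonomialOrder (Fin m)) {N M : ℕ}
    (p : (Fin m → ℕ) → K) (hbox : ∀ i : Fin m → ℕ, (∃ e, d - 1 ≤ i e) → p i = 0)
    {κ : Fin m → ℕ} (hκ : κ ∈ indexSet m d (M + N)) (hpκ : p κ ≠ 0)
    (hmax : ∀ i ∈ indexSet m d (M + N), okey mo κ < okey mo i → p i = 0) :
    (divSet κ M).card ≤ (periodMatrix m d N M p).rank := by
  classical
  obtain ⟨hκlt, hκsum⟩ := mem_indexSet.mp hκ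
  set T := divSet κ M with hT
  -- index the minor by the keys of the columns `j ∈ A_κ(M)` (a linearly ordered finite type)
  set S : Finset mo.syn := T.image (okey mo) with hS
  let dec : mo.syn → (Fin m → ℕ) := fun s => ⇑(mo.toSyn.symm s)
  have hdec : ∀ s ∈ S, dec s ∈ T ∧ okey mo (dec s) = s := by
    intro s hs
    obtain ⟨j, hj, rfl⟩ := Finset.mem_image.mp hs
    have hj' : dec (okey mo j) = j := coe_toSyn_symm_okey mo j
    rw [hj']
    exact ⟨hj, rfl⟩
  have hdecT : ∀ s : S, (∀ e, dec s.1 e ≤ κ e) ∧ ∑ e, dec s.1 e = M := fun s =>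
    mem_divSet.mp (hdec s.1 s.2).1
  have hcol : ∀ s : S, dec s.1 ∈ indexSet m d M := fun s =>
    mem_indexSet.mpr ⟨fun e => lt_of_le_of_lt ((hdecT s).1 e) (hκlt e), (hdecT s).2⟩
  have hrow : ∀ s : S, (fun e => κ e - dec s.1 e) ∈ indexSet m d N := by
    intro s
    refine mem_indexSet.mpr ⟨fun e => lt_of_le_of_lt (Nat.sub_le _ _) (hκlt e), ?_⟩
    rw [Finset.sum_tsub_distrib Finset.univ fun e _ => (hdecT s).1 e, hκsum, (hdecT s).2]
    omega
  let c : S → indexSet m d M := fun s => ⟨dec s.1, hcol s⟩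
  let r : S → indexSet m d N := fun s => ⟨fun e => κ e - dec s.1 e, hrow s⟩
  set B := (periodMatrix m d N M p).submatrix r c with hB
  have hBapply : ∀ s s' : S, B s s' = p (fun e => (κ e - dec s.1 e) + dec s'.1 e) := fun _ _ => rfl
  -- diagonal `p_κ`
  have hdiag : ∀ s : S, B s s = p κ := by
    intro s
    rw [hBapply]
    congr 1
    funext e
    have := (hdecT s).1 e
    omega
  -- lower triangular: above the diagonal the exponent `κ − j + j'` is beyond `κ` in the order
  have htri : B.BlockTriangular (⇑OrderDual.toDual) := by
    intro s s' hlt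
    rw [OrderDual.toDual_lt_toDual] at hlt
    have hlt' : okey mo (dec s.1) < okey mo (dec s'.1) := by
      rw [(hdec s.1 s.2).2, (hdec s'.1 s'.2).2]
      exact hlt
    rw [hBapply]
    set v : Fin m → ℕ := fun e => (κ e - dec s.1 e) + dec s'.1 e with hv
    by_cases hvbox : ∃ e, d - 1 ≤ v e
    · exact hbox v hvbox
    push Not at hvbox
    have hvsum : ∑ e, v e = M + N := by
      simp only [hv]
      rw [Finset.sum_add_distrib, Finset.sum_tsub_distrib Finset.univ fun e _ => (hdecT s).1 e, hκsum,
        (hdecT s).2, (hdecT s').2]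
      omega
    refine hmax v (mem_indexSet.mpr ⟨hvbox, hvsum⟩) ?_
    have hκeq : κ = fun e => (κ e - dec s.1 e) + dec s.1 e := by
      funext e
      have := (hdecT s).1 e
      omega
    rw [hκeq, hv, okey_add, okey_add]
    exact add_lt_add_of_le_of_lt le_rfl hlt'
  have hdet : B.det ≠ 0 := by
    rw [Matrix.det_of_lowerTriangular B htri, Finset.prod_congr rfl fun s _ => hdiag s, Finset.prod_const]
    exact pow_ne_zero _ hpκ
  have h := Literature.LinearAlgebra.Matrix.card_le_rank_of_det_submatrix_ne_zero
    (periodMatrix m d N M p) r c hdet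
  rwa [Fintype.card_coe, hS, Finset.card_image_of_injective _ (okey_injective mo)] at h

/-- A non-zero period vector on `I_t` has a largest exponent in its support (for any monomial order).
[cite: Movasati2017GMCD, §3.5 Proposition 7 (proof)] -/
theorem exists_max_support (mo : MonomialOrder (Fin m)) (p : (Fin m → ℕ) → K) {t : ℕ}
    (hne : ∃ i ∈ indexSet m d t, p i ≠ 0) :
    ∃ κ ∈ indexSet m d t, p κ ≠ 0 ∧ ∀ i ∈ indexSet m d t, okey mo κ < okey mo i → p i = 0 := by
  classical
  set F := (indexSet m d t).filter fun i => p i ≠ 0 with hF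
  have hFne : F.Nonempty := by
    obtain ⟨i, hi, hpi⟩ := hne
    exact ⟨i, Finset.mem_filter.mpr ⟨hi, hpi⟩⟩
  obtain ⟨κ, hκF, hmax⟩ := Finset.exists_max_image F (okey mo) hFne
  obtain ⟨hκ, hpκ⟩ := Finset.mem_filter.mp hκF
  refine ⟨κ, hκ, hpκ, fun i hi hlt => ?_⟩
  by_contra h
  exact absurd (hmax i (Finset.mem_filter.mpr ⟨hi, h⟩)) (not_le.mpr hlt)

/-- **Movasati's bound (Propositions 7 + 8), for every column degree**: for `d ≥ 3`, `M + N = (k+1)(d−2)` and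
every period vector `p` vanishing outside the box and not identically zero on `I_{M+N}`,
`rank [p_{i+j}]_{I_N × I_M} ≥ ciHilbert((d−1)^{k+1})(M)` — the Hilbert function, in degree `M`, of `k+1`
variables with `(d−1)`-st powers killed. For the Fermat `n`-fold (`m = n+2`, `k = n/2`, `M = d`,
`N = (n/2)d − n − 2`) this is Proposition 7 with the count of Proposition 8.
[cite: Movasati2017GMCD, §3.5 Propositions 7–8] [cite: Villaflorloyola2021, Proposition 3.3, Proposition 4.1] -/
theorem ciHilbert_le_rank_periodMatrix {k : ℕ} (hd : 3 ≤ d) {N M : ℕ} (hMN : M + N = (k + 1) * (d - 2))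
    (p : (Fin m → ℕ) → K) (hbox : ∀ i : Fin m → ℕ, (∃ e, d - 1 ≤ i e) → p i = 0)
    (hne : ∃ i ∈ indexSet m d (M + N), p i ≠ 0) :
    Kloosterman2023.ciHilbert (List.replicate (k + 1) (d - 1)) M ≤ (periodMatrix m d N M p).rank := by
  classical
  obtain ⟨κ, hκ, hpκ, hmax⟩ := exists_max_support MonomialOrder.degLex p hne
  obtain ⟨hκlt, hκsum⟩ := mem_indexSet.mp hκ
  refine le_trans ?_ (card_divSet_le_rank_periodMatrix MonomialOrder.degLex p hbox hκ hpκ hmax)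
  have h := ciHilbert_le_card_divSet (c := d - 2) (k := k) (by omega) (κ := κ) (fun e => by
    have := hκlt e; omega) (by rw [hκsum, hMN]) M
  rwa [show d - 2 + 1 = d - 1 by omega] at h

/-- **Movasati's Theorem 2 at the tangent level, as printed** (`M = d`, `d ≥ 3`): every non-zero period vector
of the box gives `rank [p_{i+j}]_{I_N × I_d} ≥ C(k+d, d) − (k+1)²`, `N + d = (k+1)(d−2)` — "all the components
of the Hodge locus passing through the Fermat point have codimension `≥ C(n/2+d, d) − (n/2+1)²`", read through
Theorem 6 of [Movasati2016Periods] (`codim T_0V_δ = rank [p_{i+j}]`, not formalised) with `k = n/2`.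
[cite: Movasati2017GMCD, Theorem 2, §3.5 Propositions 7–8] [cite: Villaflorloyola2021, Proposition 4.1 (des1)] -/
theorem choose_sub_sq_le_rank_periodMatrix {k : ℕ} (hd : 3 ≤ d) {N : ℕ} (hN : d + N = (k + 1) * (d - 2))
    (p : (Fin m → ℕ) → K) (hbox : ∀ i : Fin m → ℕ, (∃ e, d - 1 ≤ i e) → p i = 0)
    (hne : ∃ i ∈ indexSet m d (d + N), p i ≠ 0) :
    (k + d).choose d - (k + 1) ^ 2 ≤ (periodMatrix m d N d p).rank := by
  rw [← ciHilbert_replicate_eq_choose_sub_sq k hd]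
  exact ciHilbert_le_rank_periodMatrix hd hN p hbox hne

end Rank

/-! ## Theorem 2 in the census parametrisation `(n, d)`: the bound, and its sharpness by linear cycles -/

section Census

open Movasati2016 MovasatiVillaflor2018

variable {K : Type*} [Field K] {n d : ℕ}

/-- Degree bookkeeping: `d + ((n/2)d − n − 2) = (n/2+1)(d−2)` for `n = 2k`, `n + 2 ≤ k·d`. [folklore] -/
private theorem deg_add_rowDeg {k : ℕ} (hk : n = 2 * k) (hN : n + 2 ≤ k * d) :
    d + (k * d - n - 2) = (k + 1) * (d - 2) := by
  subst hk
  obtain ⟨d', rfl⟩ : ∃ d', d = d' + 2 := ⟨d - 2, by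
    by_contra h
    have : k * d ≤ k * 1 := Nat.mul_le_mul_left k (by omega)
    omega⟩
  have e1 : (k + 1) * (d' + 2 - 2) = k * d' + d' := by rw [Nat.add_sub_cancel]; ring
  have e2 : k * (d' + 2) = k * d' + 2 * k := by ring
  rw [e2] at hN
  rw [e1, e2]
  omega

/-- `d ≥ 2 + 4/n` forces `d ≥ 3`. [folklore] -/
private theorem three_le_of_bound (hN : n + 2 ≤ n / 2 * d) : 3 ≤ d := by
  by_contra h
  have : n / 2 * d ≤ n / 2 * 2 := Nat.mul_le_mul_left _ (by omega)
  omega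

/-- **Movasati's Theorem 2 at the Fermat point (tangent form), census parametrisation.** For the Fermat
`n`-fold of degree `d` (`n` even, `d ≥ 2 + 4/n`, i.e. `n + 2 ≤ (n/2)·d`) and EVERY period vector `p` — zero
outside Movasati's box, non-zero somewhere on `I_{(n/2+1)d−n−2}` — the matrix `[p_{i+j}]` of Definition 1
(rows `I_{(n/2)d−n−2}`, columns `I_d`) has `rank ≥ C(n/2+d, d) − (n/2+1)²`. With Theorem 6 of
[Movasati2016Periods] (`ker [p_{i+j}] = T_0V_{δ}`, transcendental, not formalised) this is "all the components
of the Hodge locus passing through the Fermat point have codimension `≥ C(n/2+d,d) − (n/2+1)²`".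
[cite: Movasati2017GMCD, Theorem 2, §3.5 Propositions 7–8] [cite: Villaflorloyola2021, Proposition 4.1 (des1)] -/
theorem movasati_rank_periodMatrix_ge (hn : Even n) (hN : n + 2 ≤ n / 2 * d) (p : (Fin (n + 2) → ℕ) → K)
    (hbox : ∀ i : Fin (n + 2) → ℕ, (∃ e, d - 1 ≤ i e) → p i = 0)
    (hne : ∃ i ∈ indexSet (n + 2) d ((n / 2 + 1) * (d - 2)), p i ≠ 0) :
    (n / 2 + d).choose d - (n / 2 + 1) ^ 2 ≤ (periodMatrix (n + 2) d (n / 2 * d - n - 2) d p).rank := by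
  have hk : n = 2 * (n / 2) := by obtain ⟨r, hr⟩ := hn; omega
  have hdeg := deg_add_rowDeg hk hN
  rw [← hdeg] at hne
  exact choose_sub_sq_le_rank_periodMatrix (three_le_of_bound hN) hdeg p hbox hne

/-- The same bound with the tree's name for its right-hand side, `Villaflor2022.movasatiBound n d = C(n/2+d,d) − (n/2+1)²`
(over `ℤ`). [cite: Movasati2017GMCD, Theorem 2] [cite: Villaflorloyola2021, (cota)] -/
theorem movasatiBound_le_rank_periodMatrix (hn : Even n) (hN : n + 2 ≤ n / 2 * d) (p : (Fin (n + 2) → ℕ) → K)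
    (hbox : ∀ i : Fin (n + 2) → ℕ, (∃ e, d - 1 ≤ i e) → p i = 0)
    (hne : ∃ i ∈ indexSet (n + 2) d ((n / 2 + 1) * (d - 2)), p i ≠ 0) :
    Villaflor2022.movasatiBound n d ≤ ((periodMatrix (n + 2) d (n / 2 * d - n - 2) d p).rank : ℤ) := by
  have h := movasati_rank_periodMatrix_ge hn hN p hbox hne
  have hle : (n / 2 + 1) ^ 2 ≤ (n / 2 + d).choose d := by
    have := DuqueFrancoVillaflor2025.linC_closed_form 0 (n / 2) d (three_le_of_bound hN); omega
  unfold Villaflor2022.movasatiBound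
  generalize (n / 2 + 1) ^ 2 = S at h hle ⊢
  omega

/-- The exponent `κ₀ = (d−2, 0, d−2, 0, …)` (concentrated shape) lies in `I_{(n/2+1)(d−2)}` and carries a non-zero
period of the standard linear cycle `x_{2e} = ζ x_{2e+1}`. [cite: MovasatiVillaflor2018, Theorem 1]
[cite: Movasati2017GMCD, §3.5 (end: "Such numbers are the periods of the projective space")] -/
theorem exists_linearCyclePeriod_ne_zero (hn : Even n) (hd : 2 ≤ d) {ζ : K} (hζ : ζ ≠ 0) :
    ∃ i ∈ indexSet (n + 2) d ((n / 2 + 1) * (d - 2)),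
      linearCyclePeriod n d ζ (fun _ => 0) (1 : Equiv.Perm (Fin (n + 2))) i ≠ 0 := by
  classical
  let i₀ : Fin (n + 2) → ℕ := fun x => if (x : ℕ) % 2 = 0 then d - 2 else 0
  have hpair : ∀ e : Fin (n / 2 + 1),
      i₀ ((1 : Equiv.Perm (Fin (n + 2))) ⟨2 * e, by omega⟩) +
        i₀ ((1 : Equiv.Perm (Fin (n + 2))) ⟨2 * e + 1, by omega⟩) = d - 2 := by
    intro e
    have h1 : (2 * (e : ℕ)) % 2 = 0 := by omega
    simp [i₀, h1]
  refine ⟨i₀, mem_indexSet.mpr ⟨fun x => ?_, ?_⟩, ?_⟩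
  · simp only [i₀]
    split_ifs <;> omega
  · -- `Σ_x i₀ x = Σ_e (i₀(2e) + i₀(2e+1)) = (n/2+1)(d−2)`
    rw [← Equiv.sum_comp (pairEquiv n hn), Fintype.sum_sum_type]
    simp only [pairEquiv_inl, pairEquiv_inr]
    rw [← Finset.sum_add_distrib]
    have : ∀ e : Fin (n / 2 + 1), i₀ ⟨2 * e, by omega⟩ + i₀ ⟨2 * e + 1, by omega⟩ = d - 2 := fun e => by
      simpa using hpair e
    rw [Finset.sum_congr rfl fun e _ => this e, Finset.sum_const, Finset.card_univ, Fintype.card_fin,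
      smul_eq_mul]
  · rw [linearCyclePeriod, if_pos hpair]
    simp only [Equiv.Perm.sign_one, Units.val_one, Int.cast_one, one_mul]
    exact pow_ne_zero _ hζ

/-- **Theorem 2, second sentence — the bound is sharp** ("The lower bound is obtained by the locus `H` of
hypersurfaces containing a linear projective space"; GMCD §3.5: "the number in the right hand side … is the
biggest one with such a property … Such numbers are the periods of the projective space `ℙ^{n/2}` inside the
Fermat variety"): over any field containing some `ζ ≠ 0`, `C(n/2+d, d) − (n/2+1)²` is the LEAST rank of
`[p_{i+j}]` over all admissible period vectors, the minimum being attained by the periods of a linear cycle (tree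
`MovasatiVillaflor2018.rank_periodMatrix_linearCyclePeriod`). [cite: Movasati2017GMCD, Theorem 2, §3.5]
[cite: MovasatiVillaflor2018, Theorem 1, Proposition 1] -/
theorem isLeast_rank_periodMatrix (hn : Even n) (hN : n + 2 ≤ n / 2 * d) {ζ : K} (hζ : ζ ≠ 0) :
    IsLeast {r : ℕ | ∃ p : (Fin (n + 2) → ℕ) → K, (∀ i : Fin (n + 2) → ℕ, (∃ e, d - 1 ≤ i e) → p i = 0) ∧
        (∃ i ∈ indexSet (n + 2) d ((n / 2 + 1) * (d - 2)), p i ≠ 0) ∧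
        (periodMatrix (n + 2) d (n / 2 * d - n - 2) d p).rank = r}
      ((n / 2 + d).choose d - (n / 2 + 1) ^ 2) := by
  have hd : 3 ≤ d := three_le_of_bound hN
  refine ⟨⟨linearCyclePeriod n d ζ (fun _ => 0) 1,
    fun i hi => linearCyclePeriod_eq_zero_of_le ζ _ _ hn (by omega) hi,
    exists_linearCyclePeriod_ne_zero hn (by omega) hζ,
    rank_periodMatrix_linearCyclePeriod hn hN hζ _ _⟩, ?_⟩
  rintro r ⟨p, hbox, hne, rfl⟩
  exact movasati_rank_periodMatrix_ge hn hN p hbox hne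

/-- **Every combination of linear cycles**: for `δ = Σ_k c_k [ℙ^{n/2}_{a_k,b_k}]` (coefficients in `K`, any `ζ`) whose
period vector `p(δ) = Σ c_k p(ℙ_k)` (tree `MovasatiVillaflor2018.combPeriod`; MV18 §5 `ρ_i`) does not vanish on
`I_{(n/2+1)d−n−2}`: `rank [p_{i+j}(δ)] ≥ C(n/2+d, d) − (n/2+1)²` — the sums of linear cycles of the census are the case
in point. [cite: Movasati2017GMCD, Theorem 2, §3.5 Propositions 7–8] [cite: MovasatiVillaflor2018, §5, Proposition 1] -/
theorem movasati_rank_periodMatrix_comb_ge (hn : Even n) (hN : n + 2 ≤ n / 2 * d) (ζ : K)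
    (δ : List (K × (Fin (n + 2) → ℕ) × Equiv.Perm (Fin (n + 2))))
    (hne : ∃ i ∈ indexSet (n + 2) d ((n / 2 + 1) * (d - 2)), combPeriod n d ζ δ i ≠ 0) :
    (n / 2 + d).choose d - (n / 2 + 1) ^ 2 ≤
      (periodMatrix (n + 2) d (n / 2 * d - n - 2) d (combPeriod n d ζ δ)).rank :=
  movasati_rank_periodMatrix_ge hn hN _
    (fun _ hi => combPeriod_eq_zero_of_le ζ hn (le_of_lt (three_le_of_bound hN)) δ hi) hne

end Census

/-! ## Villaflor's form: the Hilbert function of the Gorenstein ideal `J^{F,λ} = Ann(ℓ_λ)` in degree `M` -/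

section Functional

open MvPolynomial Module Movasati2016 Literature.RingTheory.MvPolynomial
  Literature.AlgebraicGeometry.Kloosterman2025

attribute [local instance] MvPolynomial.gradedAlgebra

variable {K : Type*} [Field K] {m d : ℕ}

/-- A functional concentrated in degree `t` which kills the monomials leaving the box and all the box
monomials `x^i`, `i ∈ I_t`, is zero — so a non-zero period functional has a non-zero period vector.
[cite: Movasati2016Periods, Definition 1] [cite: Villaflorloyola2021, Definition 2.1] -/
theorem eq_zero_of_forall_periodVector_eq_zero (ℓ : MvPolynomial (Fin m) K →ₗ[K] K)
    (hbox : ∀ s : Fin m →₀ ℕ, (∃ e, d - 1 ≤ s e) → ℓ (monomial s 1) = 0)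
    {t : ℕ} (hℓ : ∀ q, ℓ (homogeneousComponent t q) = ℓ q)
    (h : ∀ i ∈ indexSet m d t, periodVector ℓ i = 0) : ℓ = 0 := by
  classical
  have hmon : ∀ s : Fin m →₀ ℕ, s.degree = t → ℓ (monomial s 1) = 0 := by
    intro s hs
    by_cases hb : ∃ e, d - 1 ≤ s e
    · exact hbox s hb
    · push Not at hb
      have hmem : (⇑s : Fin m → ℕ) ∈ indexSet m d t :=
        mem_indexSet.mpr ⟨hb, by rw [← Finsupp.degree_eq_sum]; exact hs⟩
      have := h _ hmem
      rwa [periodVector, Finsupp.equivFunOnFinite_symm_coe] at this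
  refine LinearMap.ext fun q => ?_
  rw [LinearMap.zero_apply, ← hℓ q, homogeneousComponent_apply, map_sum]
  refine Finset.sum_eq_zero fun s hs => ?_
  rw [Finset.mem_filter] at hs
  rw [← mul_one (coeff s q), ← smul_eq_mul, ← smul_monomial, map_smul, hmon s hs.2, smul_zero]

/-- **The bound for the Gorenstein ideal of a non-zero functional (Villaflor's (cotatangent), every degree).**
For every non-zero functional `ℓ` on `K[x_0,…,x_{m−1}]` concentrated in degree `t = (k+1)(d−2)` and killing the
monomials with an exponent `≥ d − 1` (every period functional `ℓ_λ` of a Hodge class `λ` of the Fermat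
`n`-fold, `k = n/2`, `m = n+2`: `J^{F,λ} = Ann(ℓ_λ)` by Villaflor's Definition 2.1 / Proposition 2.2), and every
`M ≤ t`: `HF_{Ann ℓ}(M) = dim S_M − dim (Ann ℓ)_M ≥ ciHilbert((d−1)^{k+1})(M)`, the Hilbert function of the
ideal `I(ℙ^{n/2}) + J^F` of a linear cycle. [cite: Villaflorloyola2021, Proposition 4.1, (cotatangent)]
[cite: Movasati2017GMCD, §3.5 Propositions 7–8] -/
theorem ciHilbert_le_hilbert_annIdeal {k : ℕ} (hd : 3 ≤ d) (ℓ : MvPolynomial (Fin m) K →ₗ[K] K)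
    (hbox : ∀ s : Fin m →₀ ℕ, (∃ e, d - 1 ≤ s e) → ℓ (monomial s 1) = 0)
    {t : ℕ} (hℓ : ∀ q, ℓ (homogeneousComponent t q) = ℓ q) (ht : t = (k + 1) * (d - 2)) (hne : ℓ ≠ 0)
    {M : ℕ} (hM : M ≤ t) :
    Kloosterman2023.ciHilbert (List.replicate (k + 1) (d - 1)) M ≤
      finrank K (homogeneousSubmodule (Fin m) K M) - finrank K (idealDegree (annIdeal ℓ) M) := by
  have hMN : M + (t - M) = t := by omega
  rw [← rank_periodMatrix_eq_hilbert ℓ hbox hℓ hMN]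
  refine ciHilbert_le_rank_periodMatrix hd (by rw [hMN, ht]) (periodVector ℓ) (fun i hi => ?_) ?_
  · obtain ⟨e, he⟩ := hi
    exact hbox _ ⟨e, he⟩
  · by_contra h
    push Not at h
    rw [hMN] at h
    exact hne (eq_zero_of_forall_periodVector_eq_zero ℓ hbox hℓ h)

/-- **Villaflor's Proposition 4.1, (des1) / Movasati's (cotatangent) at the Fermat point**: in the column
degree `M = d` (`d ≤ t`, i.e. `d ≥ 2 + 4/n` in Movasati's Theorem 2), `HF_{Ann ℓ}(d) ≥ C(k+d, d) − (k+1)²`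
for every non-zero `ℓ` as above — "`dim R^{F,λ}_d ≥ C(n/2+d, d) − (n/2+1)²` for all local Hodge loci `V_λ`
passing through the Fermat variety" read through `T_0V_λ ≅ (J^{F,λ})_d^⊥` (Proposition 2.1, not formalised).
[cite: Villaflorloyola2021, Proposition 4.1 (des1)] [cite: Movasati2017GMCD, Theorem 2] -/
theorem choose_sub_sq_le_hilbert_annIdeal {k : ℕ} (hd : 3 ≤ d) (ℓ : MvPolynomial (Fin m) K →ₗ[K] K)
    (hbox : ∀ s : Fin m →₀ ℕ, (∃ e, d - 1 ≤ s e) → ℓ (monomial s 1) = 0)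
    {t : ℕ} (hℓ : ∀ q, ℓ (homogeneousComponent t q) = ℓ q) (ht : t = (k + 1) * (d - 2)) (hne : ℓ ≠ 0)
    (hdt : d ≤ t) :
    (k + d).choose d - (k + 1) ^ 2 ≤
      finrank K (homogeneousSubmodule (Fin m) K d) - finrank K (idealDegree (annIdeal ℓ) d) := by
  rw [← ciHilbert_replicate_eq_choose_sub_sq k hd]
  exact ciHilbert_le_hilbert_annIdeal hd ℓ hbox hℓ ht hne hdt

end Functional

/-! ## The colon ideals `(J^F : P)` of the Fermat Jacobian ideal (Duque Franco–Villaflor's `J^{F,λ} = (J^F : P_λ)`) -/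

section Fermat

open MvPolynomial Module Literature.RingTheory.MvPolynomial Literature.AlgebraicGeometry.Kloosterman2025
  Literature.AlgebraicGeometry.HodgeTheory

attribute [local instance] MvPolynomial.gradedAlgebra

variable {K : Type*} [Field K] {m d : ℕ}

/-- **The bound for the colon ideals of the Fermat Jacobian ideal.** `J = (x_0^{d−1}, …, x_{m−1}^{d−1})` (the
Jacobian ideal of `Σ x_i^d` when `d ∈ K^×`), `P ∉ J` a form of degree `e₀` with `e₀ + t = m(d−2)` (the socle
degree of `S/J`) and `t = (k+1)(d−2)` (for the Fermat `n`-fold: `m = n+2`, `k = n/2`, `e₀ = t = σ`, `P = P_λ`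
the polynomial of a Hodge class, `(J : P_λ) = J^{F,λ}`): for every `M ≤ t`,
`dim S_M − dim (J : P)_M ≥ ciHilbert((d−1)^{k+1})(M)`. [cite: Villaflorloyola2021, Proposition 4.1, Proposition 2.2]
[cite: Movasati2017GMCD, §3.5 Propositions 7–8] -/
theorem ciHilbert_le_hilbert_fermat_colon {k : ℕ} (hd : 3 ≤ d) {P : MvPolynomial (Fin m) K} {e₀ t : ℕ}
    (hP : P.IsHomogeneous e₀) (het : e₀ + t = m * (d - 2)) (ht : t = (k + 1) * (d - 2))
    (hPJ : P ∉ Ideal.span (Set.range fun i : Fin m => (X i : MvPolynomial (Fin m) K) ^ (d - 1)))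
    {M : ℕ} (hM : M ≤ t) :
    Kloosterman2023.ciHilbert (List.replicate (k + 1) (d - 1)) M ≤
      finrank K (homogeneousSubmodule (Fin m) K M) -
        finrank K (idealDegree
          ((Ideal.span (Set.range fun i : Fin m => (X i : MvPolynomial (Fin m) K) ^ (d - 1))).colon {P}) M) := by
  classical
  have he : 1 ≤ d - 1 := by omega
  set ℓP := fermatSocleFunctional K (Fin m) (d - 1) ∘ₗ LinearMap.mulRight K P with hℓP
  rw [span_X_pow_colon_eq_annIdeal he P]
  refine ciHilbert_le_hilbert_annIdeal hd ℓP (fun s hs => ?_) (fun q => ?_) ht ?_ hM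
  · -- `x^s ∈ J ⊆ Ann(ℓ_P)` for a box-leaving `s`
    have hsJ : (monomial s (1 : K)) ∈
        Ideal.span (Set.range fun i : Fin m => (X i : MvPolynomial (Fin m) K) ^ (d - 1)) := by
      rw [mem_span_X_pow_iff]
      intro c hc
      rw [Finset.mem_singleton.mp (support_monomial_subset hc)]
      exact hs
    refine apply_eq_zero_of_mem_annIdeal (annIdeal_le_annIdeal_comp_mulRight _ P ?_)
    rwa [annIdeal_fermatSocleFunctional he]
  · -- `ℓ_P` is concentrated in degree `t`
    have het' : e₀ + t = Fintype.card (Fin m) * (d - 1 - 1) := by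
      rw [Fintype.card_fin, show d - 1 - 1 = d - 2 by omega]
      exact het
    exact comp_mulRight_homogeneousComponent fermatSocleFunctional_homogeneousComponent hP het' q
  · -- `ℓ_P ≠ 0` since `P ∉ J`
    intro h0
    have htop : annIdeal ℓP = ⊤ := annIdeal_eq_top_iff.mpr h0
    rw [hℓP, annIdeal_comp_mulRight_eq_top_iff, annIdeal_fermatSocleFunctional he] at htop
    exact hPJ htop

/-- `(J : P)` in the degree-`d` column, `d ≤ t`: `dim S_d − dim (J : P)_d ≥ C(k+d, d) − (k+1)²`.
[cite: Villaflorloyola2021, Proposition 4.1 (des1)] [cite: Movasati2017GMCD, Theorem 2] -/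
theorem choose_sub_sq_le_hilbert_fermat_colon {k : ℕ} (hd : 3 ≤ d) {P : MvPolynomial (Fin m) K} {e₀ t : ℕ}
    (hP : P.IsHomogeneous e₀) (het : e₀ + t = m * (d - 2)) (ht : t = (k + 1) * (d - 2))
    (hPJ : P ∉ Ideal.span (Set.range fun i : Fin m => (X i : MvPolynomial (Fin m) K) ^ (d - 1)))
    (hdt : d ≤ t) :
    (k + d).choose d - (k + 1) ^ 2 ≤
      finrank K (homogeneousSubmodule (Fin m) K d) -
        finrank K (idealDegree
          ((Ideal.span (Set.range fun i : Fin m => (X i : MvPolynomial (Fin m) K) ^ (d - 1))).colon {P}) d) := by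
  rw [← ciHilbert_replicate_eq_choose_sub_sq k hd]
  exact ciHilbert_le_hilbert_fermat_colon hd hP het ht hPJ hdt

/-- **The Fermat case of the generalised Green–Otwinowska bound** (the shape of the route crux
`JacobianRankLowerBound` of `Summits/HodgeConjecture/…/Theses/ShortHodgeVectors.lean`, which records "known …
Fermat F (Movasati 2017)"): for `F = Σ_{i<2p+2} x_i^d` over a field in which `d ≠ 0`, `d ≥ 3`, `p ≥ 1`, Jacobian
ideal `J = (∂_j F) = (x_j^{d−1})`, and every form `P` of degree `(p+1)(d−2)` not in `J`:
`dim {G ∈ S_d : G·P ∈ J} + (C(d+p, p) − (p+1)²) ≤ dim S_d = C(d+2p+1, 2p+1)`.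
[cite: Movasati2017GMCD, Theorem 2, §3.5 Propositions 7–8] [cite: Villaflorloyola2021, Proposition 4.1 (des1)] -/
theorem fermat_jacobianRankLowerBound (p d : ℕ) (hp : 1 ≤ p) (hd : 3 ≤ d) (hdK : (d : K) ≠ 0)
    (P : MvPolynomial (Fin (2 * p + 2)) K) (hP : P.IsHomogeneous ((p + 1) * (d - 2)))
    (hPJ : P ∉ Ideal.span (Set.range fun j : Fin (2 * p + 2) =>
      pderiv j (∑ i : Fin (2 * p + 2), (X i : MvPolynomial (Fin (2 * p + 2)) K) ^ d))) :
    finrank K ↥(((Ideal.span (Set.range fun j : Fin (2 * p + 2) =>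
        pderiv j (∑ i : Fin (2 * p + 2), (X i : MvPolynomial (Fin (2 * p + 2)) K) ^ d))).restrictScalars K).comap
          (LinearMap.mulRight K P) ⊓ homogeneousSubmodule (Fin (2 * p + 2)) K d) +
      ((d + p).choose p - (p + 1) ^ 2) ≤ (d + 2 * p + 1).choose (2 * p + 1) := by
  classical
  -- the Jacobian ideal of the Fermat polynomial is the monomial complete intersection `(x_j^{d−1})`
  have hJ : Ideal.span (Set.range fun j : Fin (2 * p + 2) =>
      pderiv j (∑ i : Fin (2 * p + 2), (X i : MvPolynomial (Fin (2 * p + 2)) K) ^ d)) =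
      Ideal.span (Set.range fun i : Fin (2 * p + 2) => (X i : MvPolynomial (Fin (2 * p + 2)) K) ^ (d - 1)) := by
    have h := span_pderiv_sum_X_pow_succ (σ := Fin (2 * p + 2)) (R := K) (d - 1)
      (isUnit_iff_ne_zero.mpr (by rw [show d - 1 + 1 = d by omega]; exact hdK))
    rwa [show d - 1 + 1 = d by omega] at h
  rw [hJ] at hPJ ⊢
  -- `{G : G P ∈ J} ∩ S_d = (J : P)_d`
  have hcolon : ((Ideal.span (Set.range fun i : Fin (2 * p + 2) =>
        (X i : MvPolynomial (Fin (2 * p + 2)) K) ^ (d - 1))).restrictScalars K).comap (LinearMap.mulRight K P) ⊓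
        homogeneousSubmodule (Fin (2 * p + 2)) K d =
      idealDegree ((Ideal.span (Set.range fun i : Fin (2 * p + 2) =>
        (X i : MvPolynomial (Fin (2 * p + 2)) K) ^ (d - 1))).colon {P}) d := by
    ext G
    simp only [idealDegree, Submodule.mem_inf, Submodule.mem_comap, Submodule.restrictScalars_mem,
      LinearMap.mulRight_apply, Submodule.mem_colon_singleton, smul_eq_mul]
  rw [hcolon]
  -- `dim S_d = C(d + 2p + 1, 2p + 1)`
  haveI : Module.Finite K (homogeneousSubmodule (Fin (2 * p + 2)) K d) :=
    Module.Finite.iff_fg.mpr (homogeneousSubmodule_fg _ K d)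
  have hSd : finrank K (homogeneousSubmodule (Fin (2 * p + 2)) K d) = (d + 2 * p + 1).choose (2 * p + 1) := by
    rw [Literature.RingTheory.HilbertSamuel.finrank_homogeneousSubmodule_fin,
      show d + (2 * p + 2) - 1 = d + (2 * p + 1) by omega, Nat.choose_symm_add,
      show d + (2 * p + 1) = d + 2 * p + 1 from (Nat.add_assoc _ _ _).symm]
  have hle : finrank K (idealDegree ((Ideal.span (Set.range fun i : Fin (2 * p + 2) =>
        (X i : MvPolynomial (Fin (2 * p + 2)) K) ^ (d - 1))).colon {P}) d) ≤
      finrank K (homogeneousSubmodule (Fin (2 * p + 2)) K d) :=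
    Submodule.finrank_mono inf_le_right
  have hd2 : d = (d - 2) + 2 := by omega
  by_cases hdt : d ≤ (p + 1) * (d - 2)
  · have h := choose_sub_sq_le_hilbert_fermat_colon (K := K) (k := p) (m := 2 * p + 2) hd hP
      (t := (p + 1) * (d - 2)) (by ring) rfl hPJ hdt
    rw [Nat.add_comm p d, Nat.choose_symm_add] at h
    omega
  · -- only `(p, d) = (1, 3)` remains, where the bound `C(4,1) − 4` vanishes
    have hp1 : p = 1 := by
      by_contra hp1
      refine hdt ?_
      have h2 : 2 ≤ p := by omega
      have h1 : 1 ≤ d - 2 := by omega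
      calc d = (d - 2) + 2 := hd2
        _ ≤ (p + 1) * (d - 2) := by nlinarith
    have hd3 : d = 3 := by
      by_contra hd3
      refine hdt ?_
      subst hp1
      omega
    subst hp1 hd3
    norm_num at hSd ⊢
    omega

end Fermat


/-! ## The equality case of the count (Villaflor, Proposition 3.3: strictness) and of the rank bound -/

section Equality

open Finset Movasati2016

variable {τ : Type*} [Fintype τ] [DecidableEq τ]

/-- A vector below `g` of any prescribed total `M ≤ |g|` exists. [folklore] -/
private theorem exists_le_sum_eq (g : τ → ℕ) {M : ℕ} (hM : M ≤ ∑ e, g e) :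
    ∃ γ : τ → ℕ, (∀ e, γ e ≤ g e) ∧ ∑ e, γ e = M := by
  suffices h : ∀ (t : ℕ) (g : τ → ℕ), ∑ e, g e = t → ∀ M ≤ t,
      ∃ γ : τ → ℕ, (∀ e, γ e ≤ g e) ∧ ∑ e, γ e = M from h _ g rfl M hM
  intro t
  induction t with
  | zero =>
    intro g hg M hM
    exact ⟨g, fun e => le_rfl, by rw [hg]; omega⟩
  | succ t ih =>
    intro g hg M hM
    by_cases hMt : M = t + 1
    · exact ⟨g, fun e => le_rfl, by rw [hg, hMt]⟩
    · -- lower one positive coordinate of `g` and recurse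
      have hpos : ∃ e, 0 < g e := by
        by_contra h
        push Not at h
        have : ∑ e, g e = 0 := Finset.sum_eq_zero fun e _ => Nat.le_zero.mp (h e)
        omega
      obtain ⟨e₀, he₀⟩ := hpos
      have hsum' : ∑ e, Function.update g e₀ (g e₀ - 1) e = t := by
        have h := Finset.sum_update_of_mem (Finset.mem_univ e₀) g (g e₀ - 1)
        have h' := Finset.sum_eq_add_sum_sdiff_singleton_of_mem (Finset.mem_univ e₀) g
        rw [h]
        omega
      obtain ⟨γ, hγle, hγsum⟩ := ih (Function.update g e₀ (g e₀ - 1)) hsum' M (by omega)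
      refine ⟨γ, fun e => le_trans (hγle e) ?_, hγsum⟩
      rcases eq_or_ne e e₀ with rfl | hne
      · rw [Function.update_self]; omega
      · rw [Function.update_of_ne hne]

/-- Villaflor's map `f : S^M_{α'} → S^M_α` packaged with the properties its proof uses: it maps `A_{κ'}(M)`
injectively into `A_κ(M)` (`κ' = κ − e_i + e_j`), and every image has `β_i ≥ 1` or `β_j < κ_j`.
[cite: Villaflorloyola2021, Proposition 3.3 (proof)] -/
private theorem exists_shiftMap (κ : τ → ℕ) {i j : τ} (hij : i ≠ j) (hi : 0 < κ i) (hle : κ i ≤ κ j) (M : ℕ) :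
    ∃ f : (τ → ℕ) → (τ → ℕ), Set.MapsTo f ↑(divSet (shift κ i j) M) ↑(divSet κ M) ∧
      Set.InjOn f ↑(divSet (shift κ i j) M) ∧
      ∀ β ∈ divSet (shift κ i j) M, 0 < f β i ∨ f β j < κ j := by
  let f : (τ → ℕ) → (τ → ℕ) := fun β =>
    if 0 < β j then Function.update (Function.update β i (β i + 1)) j (β j - 1)
    else Function.update (Function.update β i 0) j (β i)
  have hf1 : ∀ β : τ → ℕ, 0 < β j →
      f β i = β i + 1 ∧ f β j = β j - 1 ∧ ∀ e, e ≠ i → e ≠ j → f β e = β e := by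
    intro β hβ
    simp only [f, if_pos hβ]
    refine ⟨by simp [hij], by simp, fun e hei hej => by simp [hei, hej]⟩
  have hf2 : ∀ β : τ → ℕ, ¬ 0 < β j →
      f β i = 0 ∧ f β j = β i ∧ ∀ e, e ≠ i → e ≠ j → f β e = β e := by
    intro β hβ
    simp only [f, if_neg hβ]
    refine ⟨by simp [hij], by simp, fun e hei hej => by simp [hei, hej]⟩
  have hsum1 : ∀ β : τ → ℕ, 0 < β j → ∑ e, f β e = ∑ e, β e := by
    intro β hβ
    have h := sum_update_update β hij (β i + 1) (β j - 1)
    simp only [f, if_pos hβ]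
    omega
  have hsum2 : ∀ β : τ → ℕ, ¬ 0 < β j → ∑ e, f β e = ∑ e, β e := by
    intro β hβ
    have h := sum_update_update β hij 0 (β i)
    simp only [f, if_neg hβ]
    omega
  refine ⟨f, fun β hβ => ?_, fun β hβ γ hγ hfg => ?_, fun β hβ => ?_⟩
  · -- maps into `A_κ(M)`
    have hβ' := mem_divSet.mp (Finset.mem_coe.mp hβ)
    rw [Finset.mem_coe, mem_divSet]
    by_cases hj : 0 < β j
    · obtain ⟨h1, h2, h3⟩ := hf1 β hj
      refine ⟨fun e => ?_, by rw [hsum1 β hj, hβ'.2]⟩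
      by_cases hei : e = i
      · subst hei; rw [h1]; have := hβ'.1 e; rw [shift_apply_left κ hij] at this; omega
      by_cases hej : e = j
      · subst hej; rw [h2]; have := hβ'.1 e; rw [shift_apply_right] at this; omega
      rw [h3 e hei hej]; have := hβ'.1 e; rwa [shift_apply_of_ne κ hei hej] at this
    · obtain ⟨h1, h2, h3⟩ := hf2 β hj
      refine ⟨fun e => ?_, by rw [hsum2 β hj, hβ'.2]⟩
      by_cases hei : e = i
      · subst hei; rw [h1]; exact Nat.zero_le _
      by_cases hej : e = j
      · subst hej; rw [h2]; have := hβ'.1 i; rw [shift_apply_left κ hij] at this; omega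
      rw [h3 e hei hej]; have := hβ'.1 e; rwa [shift_apply_of_ne κ hei hej] at this
  · -- injective on `A_{κ'}(M)`
    by_cases hbj : 0 < β j <;> by_cases hgj : 0 < γ j
    · obtain ⟨h1, h2, h3⟩ := hf1 β hbj
      obtain ⟨h1', h2', h3'⟩ := hf1 γ hgj
      funext e
      by_cases hei : e = i
      · subst hei; have := congr_fun hfg e; rw [h1, h1'] at this; omega
      by_cases hej : e = j
      · subst hej; have := congr_fun hfg e; rw [h2, h2'] at this; omega
      have := congr_fun hfg e; rwa [h3 e hei hej, h3' e hei hej] at this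
    · have := congr_fun hfg i
      rw [(hf1 β hbj).1, (hf2 γ hgj).1] at this
      omega
    · have := congr_fun hfg i
      rw [(hf2 β hbj).1, (hf1 γ hgj).1] at this
      omega
    · obtain ⟨h1, h2, h3⟩ := hf2 β hbj
      obtain ⟨h1', h2', h3'⟩ := hf2 γ hgj
      funext e
      by_cases hei : e = i
      · subst hei; have := congr_fun hfg j; rw [h2, h2'] at this; exact this
      by_cases hej : e = j
      · subst hej; omega
      have := congr_fun hfg e; rwa [h3 e hei hej, h3' e hei hej] at this
  · -- images have `β_i ≥ 1` or `β_j < κ_j`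
    by_cases hj : 0 < β j
    · left; rw [(hf1 β hj).1]; omega
    · right; rw [(hf2 β hj).2.1]
      have := (mem_divSet.mp hβ).1 i
      rw [shift_apply_left κ hij] at this
      omega

/-- **Strictness of the shift (Villaflor, Proposition 3.3)**: "(tecdes) is a strict inequality if
`α_j ≤ d ≤ deg(x^α) − α_i`" — for `i ≠ j`, `0 < κ_i ≤ κ_j`, `κ_j ≤ M` and `M + κ_i ≤ |κ|`:
`#A_{κ − e_i + e_j}(M) < #A_κ(M)` (the monomials `x^β` with `β_i = 0`, `β_j = κ_j` are missed by `f`).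
[cite: Villaflorloyola2021, Proposition 3.3] -/
theorem card_divSet_shift_lt (κ : τ → ℕ) {i j : τ} (hij : i ≠ j) (hi : 0 < κ i) (hle : κ i ≤ κ j)
    {M : ℕ} (hjM : κ j ≤ M) (hMi : M + κ i ≤ ∑ e, κ e) :
    (divSet (shift κ i j) M).card < (divSet κ M).card := by
  classical
  obtain ⟨f, hmaps, hinj, himg⟩ := exists_shiftMap κ hij hi hle M
  -- a witness `β₀ ∈ A_κ(M)` with `β₀ i = 0`, `β₀ j = κ j`
  let g : τ → ℕ := Function.update (Function.update κ i 0) j 0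
  have hg : ∑ e, g e + κ i + κ j = ∑ e, κ e + 0 + 0 := sum_update_update κ hij 0 0
  obtain ⟨γ, hγle, hγsum⟩ := exists_le_sum_eq g (M := M - κ j) (by omega)
  let β₀ : τ → ℕ := Function.update γ j (κ j)
  have hγi : γ i = 0 := by have := hγle i; simp [g, hij] at this; exact this
  have hγj : γ j = 0 := by have := hγle j; simp [g] at this; exact this
  have hβ₀i : β₀ i = 0 := by simp [β₀, hij, hγi]
  have hβ₀j : β₀ j = κ j := by simp [β₀]
  have hβ₀mem : β₀ ∈ divSet κ M := by
    rw [mem_divSet]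
    refine ⟨fun e => ?_, ?_⟩
    · by_cases hej : e = j
      · subst hej; rw [hβ₀j]
      · simp only [β₀, Function.update_of_ne hej]
        refine le_trans (hγle e) ?_
        by_cases hei : e = i
        · subst hei; simp [g, hij]
        · simp [g, hei, hej]
    · have h := Finset.sum_update_of_mem (Finset.mem_univ j) γ (κ j)
      have h' := Finset.sum_eq_add_sum_sdiff_singleton_of_mem (Finset.mem_univ j) γ
      simp only [β₀]
      rw [h]
      omega
  have hβ₀not : β₀ ∉ (divSet (shift κ i j) M).image f := by
    intro hmem
    obtain ⟨β, hβ, hfβ⟩ := Finset.mem_image.mp hmem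
    rcases himg β hβ with h1 | h2
    · rw [hfβ, hβ₀i] at h1; exact lt_irrefl _ h1
    · rw [hfβ, hβ₀j] at h2; exact lt_irrefl _ h2
  calc (divSet (shift κ i j) M).card = ((divSet (shift κ i j) M).image f).card :=
        (Finset.card_image_of_injOn hinj).symm
    _ < (divSet κ M).card := Finset.card_lt_card
        ⟨Finset.image_subset_iff.mpr fun β hβ => hmaps (Finset.mem_coe.mpr hβ),
          fun hsub => hβ₀not (hsub hβ₀mem)⟩

/-- **The count is STRICTLY above the bound off the concentrated shape** (Villaflor Prop. 3.3: equality iff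
`#{α_i = d−2} = #{α_i = 0} = n/2+1`, under the degree hypothesis that makes the last shift strict): for `κ` in the
box `[0,c]^τ` with `|κ| = (k+1)c` having SOME exponent strictly between `0` and `c`, and a column degree `M` with
`c − 1 ≤ M` and `M + 1 ≤ (k+1)c` (for `M = d`, `c = d − 2`: `d ≥ 2 + 6/n`, cf. Remark 4.1),
`ciHilbert((c+1)^{k+1})(M) < #A_κ(M)`. [cite: Villaflorloyola2021, Proposition 3.3, Proposition 4.1, Remark 4.1]
[cite: Movasati2017GMCD, §3.5 Proposition 8] -/
theorem ciHilbert_lt_card_divSet {c k : ℕ} (hc : 1 ≤ c) {κ : τ → ℕ} (hle : ∀ e, κ e ≤ c)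
    (hsum : ∑ e, κ e = (k + 1) * c) (hmid : ∃ e, 0 < κ e ∧ κ e < c) {M : ℕ} (hM1 : c - 1 ≤ M)
    (hM2 : M + 1 ≤ (k + 1) * c) :
    Kloosterman2023.ciHilbert (List.replicate (k + 1) (c + 1)) M < (divSet κ M).card := by
  classical
  suffices h : ∀ (μ : ℕ) (κ : τ → ℕ), ∑ e, κ e * (c - κ e) = μ → (∀ e, κ e ≤ c) →
      ∑ e, κ e = (k + 1) * c → (∃ e, 0 < κ e ∧ κ e < c) →
      Kloosterman2023.ciHilbert (List.replicate (k + 1) (c + 1)) M < (divSet κ M).card from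
    h _ κ rfl hle hsum hmid
  intro μ
  induction μ using Nat.strong_induction_on with
  | _ μ ih =>
    intro κ hμ hle hsum hmid
    obtain ⟨i, j, hij, hi, hij', hj⟩ := exists_shift_pair hle hsum hmid
    have hle' : ∀ e, shift κ i j e ≤ c := fun e => by
      by_cases hei : e = i
      · subst hei; rw [shift_apply_left κ hij]; have := hle e; omega
      by_cases hej : e = j
      · subst hej; rw [shift_apply_right]; omega
      rw [shift_apply_of_ne κ hei hej]; exact hle e
    have hsum' : ∑ e, shift κ i j e = (k + 1) * c := by rw [sum_shift κ hij hi, hsum]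
    by_cases hmid' : ∃ e, 0 < shift κ i j e ∧ shift κ i j e < c
    · -- not the last shift: strict by induction, then the weak step
      have hlt := potential_shift_lt κ hij hi hij' hj
      rw [hμ] at hlt
      exact lt_of_lt_of_le (ih _ hlt _ rfl hle' hsum' hmid') (card_divSet_shift_le κ hij hi hij' M)
    · -- the last shift (`κ_i = 1`, `κ_j = c − 1`): it is strict, and the weak bound holds after it
      push Not at hmid'
      have hκj : κ j = c - 1 := by
        have h1 := hmid' j
        rw [shift_apply_right] at h1
        by_contra hne
        exact absurd (h1 (Nat.succ_pos _)) (by omega)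
      have hκi : κ i = 1 := by
        have h1 := hmid' i
        rw [shift_apply_left κ hij] at h1
        by_contra hne
        have hpos : 0 < κ i - 1 := by omega
        have := h1 hpos
        omega
      refine lt_of_le_of_lt (ciHilbert_le_card_divSet hc hle' hsum' M) ?_
      exact card_divSet_shift_lt κ hij hi hij' (by omega) (by rw [hsum]; omega)

/-- **Equality iff concentrated** (Villaflor Prop. 3.3 "with equality if and only if … up to some relabeling of the
coordinates `α = (0,…,0,d−2,…,d−2)`", in the degree range where it holds): for `κ ∈ [0,c]^τ`, `|κ| = (k+1)c`,
`c − 1 ≤ M`, `M + 1 ≤ (k+1)c`: `#A_κ(M) = ciHilbert((c+1)^{k+1})(M) ↔` every exponent of `κ` is `0` or `c`.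
[cite: Villaflorloyola2021, Proposition 3.3] [cite: Movasati2017GMCD, §3.5 Proposition 8] -/
theorem card_divSet_eq_ciHilbert_iff {c k : ℕ} (hc : 1 ≤ c) {κ : τ → ℕ} (hle : ∀ e, κ e ≤ c)
    (hsum : ∑ e, κ e = (k + 1) * c) {M : ℕ} (hM1 : c - 1 ≤ M) (hM2 : M + 1 ≤ (k + 1) * c) :
    (divSet κ M).card = Kloosterman2023.ciHilbert (List.replicate (k + 1) (c + 1)) M ↔
      ∀ e, κ e = 0 ∨ κ e = c := by
  classical
  constructor
  · intro h e
    by_contra hne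
    push Not at hne
    have hlt := ciHilbert_lt_card_divSet hc hle hsum ⟨e, by have := hle e; omega⟩ hM1 hM2
    omega
  · intro h
    set E : Finset τ := Finset.univ.filter fun e => κ e = c with hE
    have hκ : κ = fun e => if e ∈ E then c else 0 := by
      funext e
      by_cases he : e ∈ E
      · rw [if_pos he]; simpa [hE] using he
      · rw [if_neg he]
        have hne : κ e ≠ c := by simpa [hE] using he
        rcases h e with h0 | hc' <;> omega
    have hcardE : E.card = k + 1 := by
      have h1 : ∑ e, κ e = E.card * c := by
        conv_lhs => rw [hκ]
        rw [← Finset.sum_filter, Finset.filter_mem_eq_inter, Finset.univ_inter, Finset.sum_const, smul_eq_mul]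
      rw [hsum] at h1
      exact (Nat.eq_of_mul_eq_mul_right hc h1).symm
    rw [hκ, card_divSet_indicator, hcardE]

variable {K : Type*} [Field K] {m d : ℕ}

/-- **Equality in Movasati's bound forces a concentrated leading exponent (Villaflor, Proposition 4.1, (igualdad1))**:
if a period vector `p` of the box has `rank [p_{i+j}]_{I_N × I_M} = ciHilbert((d−1)^{k+1})(M)` with
`M + N = (k+1)(d−2)`, `d − 3 ≤ M` and `M + 1 ≤ (k+1)(d−2)` (for `M = d`: `d ≥ 2 + 6/n` — "the condition
`d ≥ 2 + 6/n` cannot be improved since for `(n,d) = (2,4), (4,3)` the equality in (des1) is attained by all local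
Hodge loci", Remark 4.1), then for EVERY monomial order the largest exponent `κ ∈ I_{M+N}` with `p_κ ≠ 0` has all its
entries in `{0, d−2}` — Villaflor's `x^α = x_{i_1}^{d−2} ⋯ x_{i_{n/2+1}}^{d−2}`.
[cite: Villaflorloyola2021, Proposition 4.1 (igualdad1), Remark 4.1] [cite: Movasati2017GMCD, §3.5 Propositions 7–8] -/
theorem leadingExponent_mem_of_rank_eq (mo : MonomialOrder (Fin m)) {k : ℕ} (hd : 3 ≤ d) {N M : ℕ}
    (hMN : M + N = (k + 1) * (d - 2)) (hM1 : d - 3 ≤ M) (hM2 : M + 1 ≤ (k + 1) * (d - 2))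
    (p : (Fin m → ℕ) → K) (hbox : ∀ i : Fin m → ℕ, (∃ e, d - 1 ≤ i e) → p i = 0)
    {κ : Fin m → ℕ} (hκ : κ ∈ indexSet m d (M + N)) (hpκ : p κ ≠ 0)
    (hmax : ∀ i ∈ indexSet m d (M + N), okey mo κ < okey mo i → p i = 0)
    (hrank : (periodMatrix m d N M p).rank = Kloosterman2023.ciHilbert (List.replicate (k + 1) (d - 1)) M) :
    ∀ e, κ e = 0 ∨ κ e = d - 2 := by
  obtain ⟨hκlt, hκsum⟩ := mem_indexSet.mp hκ
  by_contra h
  push Not at h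
  obtain ⟨e, he0, hec⟩ := h
  have hmid : ∃ e, 0 < κ e ∧ κ e < d - 2 := ⟨e, by omega, by have := hκlt e; omega⟩
  have hlt := ciHilbert_lt_card_divSet (c := d - 2) (k := k) (by omega) (κ := κ)
    (fun e => by have := hκlt e; omega) (by rw [hκsum, hMN]) hmid (M := M) (by omega) (by rw [← hMN]; omega)
  rw [show d - 2 + 1 = d - 1 by omega] at hlt
  have hle := card_divSet_le_rank_periodMatrix mo p hbox hκ hpκ hmax
  omega

/-- Census form (`M = d`): if `rank [p_{i+j}]_{I_{(n/2)d−n−2} × I_d} = C(n/2+d, d) − (n/2+1)²` for a period vector of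
the box of the Fermat `n`-fold with `d ≥ 2 + 6/n` (i.e. `(n/2)(d−2) ≥ 3`), then every leading box exponent of `p`
(any monomial order) is `(d−2)·𝟙_E`, `#E = n/2 + 1`. [cite: Villaflorloyola2021, Proposition 4.1 (igualdad1)]
[cite: Movasati2017GMCD, Theorem 2] -/
theorem leadingExponent_mem_of_rank_eq_movasatiBound {n d : ℕ} (mo : MonomialOrder (Fin (n + 2)))
    (hn : Even n) (h6 : 3 ≤ n / 2 * (d - 2)) (p : (Fin (n + 2) → ℕ) → K)
    (hbox : ∀ i : Fin (n + 2) → ℕ, (∃ e, d - 1 ≤ i e) → p i = 0)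
    {κ : Fin (n + 2) → ℕ} (hκ : κ ∈ indexSet (n + 2) d ((n / 2 + 1) * (d - 2))) (hpκ : p κ ≠ 0)
    (hmax : ∀ i ∈ indexSet (n + 2) d ((n / 2 + 1) * (d - 2)), okey mo κ < okey mo i → p i = 0)
    (hrank : (periodMatrix (n + 2) d (n / 2 * d - n - 2) d p).rank = (n / 2 + d).choose d - (n / 2 + 1) ^ 2) :
    ∀ e, κ e = 0 ∨ κ e = d - 2 := by
  have hd : 3 ≤ d := by
    by_contra h
    have : n / 2 * (d - 2) ≤ n / 2 * 0 := Nat.mul_le_mul_left _ (by omega)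
    omega
  have hk : n = 2 * (n / 2) := by obtain ⟨r, hr⟩ := hn; omega
  have hdeg : d + (n / 2 * d - n - 2) = (n / 2 + 1) * (d - 2) := by
    have e1 : n / 2 * (d - 2) = n / 2 * d - n := by
      rw [Nat.mul_sub, show n / 2 * 2 = n by omega]
    have : n + 2 ≤ n / 2 * d := by
      have : n / 2 * (d - 2) + n ≤ n / 2 * d := by rw [e1]; omega
      omega
    rw [add_mul, one_mul, e1]
    omega
  rw [← hdeg] at hκ hmax
  rw [← ciHilbert_replicate_eq_choose_sub_sq (n / 2) hd] at hrank
  have hM2 : d + 1 ≤ (n / 2 + 1) * (d - 2) := by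
    have : (n / 2 + 1) * (d - 2) = n / 2 * (d - 2) + (d - 2) := by ring
    omega
  exact leadingExponent_mem_of_rank_eq mo hd hdeg (by omega) hM2 p hbox hκ hpκ hmax hrank

end Equality

/-! ## Villaflor's Proposition 4.1, second half: equality forces `n/2+1` independent linear forms in `J^{F,λ}` -/

section LinearForms

open MvPolynomial Module Finset Movasati2016 Literature.RingTheory.MvPolynomial
  Literature.AlgebraicGeometry.Kloosterman2025

attribute [local instance] MvPolynomial.gradedAlgebra

variable {τ : Type*} [Fintype τ] [DecidableEq τ]

/-- `box_E(1)` consists of the `#E` coordinate vectors `e_j`, `j ∈ E` (exponent bound `e ≥ 2`): the degree-one value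
`#E` of the box count. [cite: Villaflorloyola2021, Proposition 4.1 (proof, "equality follows for `k = 1` by duality")] -/
theorem card_box_one (E : Finset τ) {e : ℕ} (he : 2 ≤ e) : (Villaflor2022.box E e 1).card = E.card := by
  classical
  have hinj : Function.Injective fun j : τ => Finsupp.single j (1 : ℕ) := Finsupp.single_left_injective one_ne_zero
  rw [← Finset.card_image_of_injective E hinj]
  congr 1
  ext β
  rw [Finset.mem_image, Villaflor2022.mem_box]
  constructor
  · rintro ⟨hsum, -, hoff⟩
    obtain ⟨j, hj⟩ : ∃ j, β j ≠ 0 := by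
      by_contra h
      push Not at h
      have : ∑ i, β i = 0 := Finset.sum_eq_zero fun i _ => h i
      omega
    have hj1 : β j = 1 := by
      have := Finset.single_le_sum (fun i _ => Nat.zero_le (β i)) (Finset.mem_univ j)
      omega
    refine ⟨j, ?_, ?_⟩
    · by_contra hjE
      exact hj (hoff j hjE)
    · ext i
      by_cases hij : i = j
      · subst hij; simp [hj1]
      · rw [Finsupp.single_apply, if_neg (Ne.symm hij)]
        by_contra hi
        have h2 : ∑ x ∈ ({i, j} : Finset τ), β x ≤ ∑ x, β x :=
          Finset.sum_le_sum_of_subset (Finset.subset_univ _)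
        rw [Finset.sum_pair hij] at h2
        omega
  · rintro ⟨j, hjE, rfl⟩
    refine ⟨by simp [Finsupp.single_apply], fun i => ?_, fun i hi => ?_⟩
    · rw [Finsupp.single_apply]; split_ifs <;> omega
    · rw [Finsupp.single_apply, if_neg]; rintro rfl; exact hi hjE

/-- The two extreme values of the linear-cycle count: `ciHilbert((c+1)^{k+1})(1) = k+1` and, by Gorenstein symmetry
of the box, `ciHilbert((c+1)^{k+1})((k+1)c − 1) = k+1` (`c ≥ 1`). [cite: Villaflorloyola2021, Proposition 4.1 (proof)]
[cite: Kloosterman2025, Lemma 2.1] -/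
theorem ciHilbert_replicate_one_and_sub_one (k : ℕ) {c : ℕ} (hc : 1 ≤ c) :
    Kloosterman2023.ciHilbert (List.replicate (k + 1) (c + 1)) 1 = k + 1 ∧
      Kloosterman2023.ciHilbert (List.replicate (k + 1) (c + 1)) ((k + 1) * c - 1) = k + 1 := by
  classical
  set E : Finset (Fin (k + 1)) := Finset.univ with hEdef
  have hE : E.card = k + 1 := by simp [hEdef]
  have hb : ∀ M, Kloosterman2023.ciHilbert (List.replicate (k + 1) (c + 1)) M =
      (Villaflor2022.box E (c + 1) M).card := by
    intro M
    rw [Villaflor2022.card_box_eq_ciHilbert E (by omega : 1 ≤ c + 1) M, hE]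
  have h1 : (Villaflor2022.box E (c + 1) 1).card = k + 1 := by rw [card_box_one E (by omega), hE]
  refine ⟨by rw [hb, h1], ?_⟩
  rw [hb]
  have hs := Villaflor2022.card_box_symm (E := E) (e := c + 1) (k := 1)
    (by rw [hE, Nat.add_sub_cancel]; nlinarith)
  rw [hE, Nat.add_sub_cancel] at hs
  rw [← hs, h1]

variable {K : Type*} [Field K] {m d : ℕ}

/-- A box-leaving monomial lies in `Ann ℓ` when `ℓ` kills the box-leaving monomials (`J^F ⊆ J^{F,λ}`).
[cite: Villaflorloyola2021, Proposition 2.2] -/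
theorem monomial_mem_annIdeal_of_le (ℓ : MvPolynomial (Fin m) K →ₗ[K] K)
    (hbox : ∀ s : Fin m →₀ ℕ, (∃ e, d - 1 ≤ s e) → ℓ (monomial s 1) = 0) {s : Fin m →₀ ℕ}
    (hs : ∃ e, d - 1 ≤ s e) : monomial s (1 : K) ∈ annIdeal ℓ := by
  rw [mem_annIdeal_iff]
  intro h
  rw [mul_comm]
  exact apply_mul_monomial_eq_zero_of_le ℓ hbox h hs

open Classical in
/-- Macaulay's count for `Ann ℓ` (Villaflor Prop. 3.1 / Remark 3.1): `HF_{Ann ℓ}(t)` is the number of degree-`t`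
exponents which are NOT leading exponents of `Ann ℓ` (standard monomials), for any monomial order.
[cite: Villaflorloyola2021, Proposition 3.1, Remark 3.1] -/
theorem hilbert_annIdeal_eq_card_standard (mo : MonomialOrder (Fin m)) (ℓ : MvPolynomial (Fin m) K →ₗ[K] K)
    {t₀ : ℕ} (hℓ : ∀ q, ℓ (homogeneousComponent t₀ q) = ℓ q) (t : ℕ) :
    finrank K (homogeneousSubmodule (Fin m) K t) - finrank K (idealDegree (annIdeal ℓ) t) =
      (((univ : Finset (Fin m)).finsuppAntidiag t).filter
        fun a => a ∉ leadingExponents mo (annIdeal ℓ)).card := by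
  rw [Literature.RingTheory.HilbertSamuel.finrank_homogeneousSubmodule_eq_card K (Fin m) t,
    finrank_idealDegree_eq_card mo (annIdeal ℓ) (fun f hf e => homogeneousComponent_mem_annIdeal hℓ hf e) t]
  have h := Finset.card_filter_add_card_filter_not (s := (univ : Finset (Fin m)).finsuppAntidiag t)
    (fun a => a ∈ leadingExponents mo (annIdeal ℓ))
  omega

open Classical in
/-- **Villaflor's Proposition 4.1, second half** ("Furthermore if the equality holds in (des1) and `d ≥ 2 + 6/n`, then
there exist `L_1, …, L_{n/2+1} ∈ J^{F,λ}_1` linearly independent"), for the Gorenstein ideal `Ann ℓ` of any non-zero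
functional `ℓ` concentrated in degree `σ = (k+1)(d−2)` and killing `J^F` (`m` variables; `d + 1 ≤ σ`, i.e.
`d ≥ 2 + 6/n` for `k = n/2` — Remark 4.1): if `HF_{Ann ℓ}(d) = C(k+d, d) − (k+1)²` then `HF_{Ann ℓ}(1) = k + 1`, i.e.
`(Ann ℓ)_1` has dimension `m − (k+1)` (`= n/2 + 1` linear forms for `m = n + 2`). The printed proof is followed:
the socle standard monomial `x^α` (unique, `HF(σ) = 1`) lies in the box; its divisors are standard (leading exponents
form an upper set), so `HF(d) ≥ #S^d_α ≥` the bound, and equality forces `α = (d−2)·𝟙_E`, `#E = k+1`, and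
`⟨LT⟩_d =` the complete-intersection monomials; these generate all non-divisors of `x^α` in degrees `≥ d`, whence
`HF(σ−1) ≤ #S^{σ−1}_α = k+1`, and `HF(1) = HF(σ−1)` by duality (tree `hilbert_annIdeal_symm`); the reverse inequality is
the bound in degree `1`. [cite: Villaflorloyola2021, Proposition 4.1, Remark 4.1] [cite: Movasati2017GMCD, Theorem 2] -/
theorem hilbert_annIdeal_one_eq_of_hilbert_eq {k : ℕ} (hd : 3 ≤ d) (hσ : d + 1 ≤ (k + 1) * (d - 2))
    (ℓ : MvPolynomial (Fin m) K →ₗ[K] K)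
    (hbox : ∀ s : Fin m →₀ ℕ, (∃ e, d - 1 ≤ s e) → ℓ (monomial s 1) = 0)
    {t : ℕ} (hℓ : ∀ q, ℓ (homogeneousComponent t q) = ℓ q) (ht : t = (k + 1) * (d - 2)) (hne : ℓ ≠ 0)
    (heq : finrank K (homogeneousSubmodule (Fin m) K d) - finrank K (idealDegree (annIdeal ℓ) d) =
      (k + d).choose d - (k + 1) ^ 2) :
    finrank K (homogeneousSubmodule (Fin m) K 1) - finrank K (idealDegree (annIdeal ℓ) 1) = k + 1 := by
  set mo : MonomialOrder (Fin m) := MonomialOrder.degLex with hmo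
  set E := leadingExponents mo (annIdeal ℓ) with hEdef
  have hup : IsUpperSet E := isUpperSet_leadingExponents mo _
  -- standard monomials of degree `u`
  set std : ℕ → Finset (Fin m →₀ ℕ) := fun u =>
    ((univ : Finset (Fin m)).finsuppAntidiag u).filter fun a => a ∉ E with hstd
  have hmem_std : ∀ u (β : Fin m →₀ ℕ), β ∈ std u ↔ (∑ i, β i = u) ∧ β ∉ E := by
    intro u β
    rw [hstd, Finset.mem_filter, Literature.RingTheory.MvPolynomial.mem_finsuppAntidiag_univ_iff,
      Finsupp.degree_eq_sum]
  have hHF : ∀ u, finrank K (homogeneousSubmodule (Fin m) K u) - finrank K (idealDegree (annIdeal ℓ) u) =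
      (std u).card := fun u => hilbert_annIdeal_eq_card_standard mo ℓ hℓ u
  -- (1) the socle: exactly one standard monomial `x^α` of degree `t`
  have hsoc := hilbert_annIdeal_top hℓ hne
  rw [hHF t] at hsoc
  obtain ⟨α, hα⟩ := Finset.card_eq_one.mp hsoc
  have hαmem : α ∈ std t := by rw [hα]; exact Finset.mem_singleton_self _
  obtain ⟨hαsum, hαE⟩ := (hmem_std t α).mp hαmem
  -- (2) `α` lies in the box (box-leaving monomials are in `Ann ℓ`, hence leading exponents)
  have hαbox : ∀ e, α e ≤ d - 2 := by
    intro e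
    by_contra h
    push Not at h
    refine hαE ⟨monomial α 1, monomial_mem_annIdeal_of_le ℓ hbox ⟨e, by omega⟩,
      monomial_eq_zero.not.mpr one_ne_zero, ?_⟩
    rw [MonomialOrder.degree_monomial, if_neg one_ne_zero]
  -- (3) divisors of `α` are standard
  have hdiv : ∀ β : Fin m →₀ ℕ, β ≤ α → β ∉ E := fun β hβ hβE => hαE (hup hβ hβE)
  have hdiv_card : ∀ u, (divSet (⇑α) u).card ≤ (std u).card := by
    intro u
    refine Finset.card_le_card_of_injOn (fun j => Finsupp.equivFunOnFinite.symm j) (fun j hj => ?_)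
      (fun j₁ _ j₂ _ h => Finsupp.equivFunOnFinite.symm.injective h)
    obtain ⟨hle, hsum⟩ := mem_divSet.mp (Finset.mem_coe.mp hj)
    rw [Finset.mem_coe, hmem_std]
    exact ⟨by simpa using hsum, hdiv _ fun e => by simpa using hle e⟩
  -- (4) equality in degree `d`: `#A_α(d)` is the bound, so `α` is concentrated and `std d` = divisors of `α`
  have hαsum' : ∑ e, (⇑α) e = (k + 1) * (d - 2) := by rw [← ht]; exact hαsum
  have hcount_d : (divSet (⇑α) d).card = Kloosterman2023.ciHilbert (List.replicate (k + 1) (d - 2 + 1)) d := by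
    apply le_antisymm
    · rw [show d - 2 + 1 = d - 1 by omega, ciHilbert_replicate_eq_choose_sub_sq k hd, ← heq, hHF d]
      exact hdiv_card d
    · exact ciHilbert_le_card_divSet (by omega) hαbox hαsum' d
  have hconc : ∀ e, α e = 0 ∨ α e = d - 2 :=
    (card_divSet_eq_ciHilbert_iff (c := d - 2) (k := k) (by omega) hαbox hαsum' (M := d) (by omega) hσ).mp hcount_d
  have hstd_d : ∀ β : Fin m →₀ ℕ, (∑ i, β i = d) → β ∉ E → β ≤ α := by
    intro β hβd hβE
    have himg : (divSet (⇑α) d).image (fun j => Finsupp.equivFunOnFinite.symm j) = std d := by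
      refine Finset.eq_of_subset_of_card_le (fun β' hβ' => ?_) ?_
      · obtain ⟨j, hj, rfl⟩ := Finset.mem_image.mp hβ'
        obtain ⟨hle, hsum⟩ := mem_divSet.mp hj
        rw [hmem_std]
        exact ⟨by simpa using hsum, hdiv _ fun e => by simpa using hle e⟩
      · rw [Finset.card_image_of_injective _ Finsupp.equivFunOnFinite.symm.injective, ← hHF d, heq,
          ← ciHilbert_replicate_eq_choose_sub_sq k hd, hcount_d, show d - 2 + 1 = d - 1 by omega]
    have hβ : β ∈ (divSet (⇑α) d).image (fun j => Finsupp.equivFunOnFinite.symm j) := by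
      rw [himg, hmem_std]
      exact ⟨hβd, hβE⟩
    obtain ⟨j, hj, rfl⟩ := Finset.mem_image.mp hβ
    intro e
    simpa using (mem_divSet.mp hj).1 e
  -- (5) in every degree `u ≥ d`, standard monomials divide `x^α`
  have hstd_le : ∀ u, d ≤ u → ∀ β : Fin m →₀ ℕ, (∑ i, β i = u) → β ∉ E → β ≤ α := by
    intro u hu β hβu hβE
    by_contra hnot
    obtain ⟨e, he⟩ : ∃ e, α e < β e := by
      by_contra h
      push Not at h
      exact hnot fun e => h e
    -- peel a degree-`d` part `β'` of `β` with `β'_e ≥ α_e + 1`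
    set q := α e + 1 with hq
    have hqd : q ≤ d - 1 := by have := hαbox e; omega
    let g : Fin m → ℕ := Function.update (⇑β) e (β e - q)
    have hgsum : ∑ i, g i = u - q := by
      have h1 := Finset.sum_update_of_mem (Finset.mem_univ e) (⇑β) (β e - q)
      have h2 := Finset.sum_eq_add_sum_sdiff_singleton_of_mem (Finset.mem_univ e) (⇑β)
      simp only [g]
      rw [h1]
      omega
    obtain ⟨γ, hγle, hγsum⟩ := exists_le_sum_eq g (M := d - q) (by omega)
    let β' : Fin m →₀ ℕ := Finsupp.equivFunOnFinite.symm (Function.update γ e (γ e + q))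
    have hβ'e : β' e = γ e + q := by simp [β']
    have hβ'ne : ∀ i, i ≠ e → β' i = γ i := fun i hi => by simp [β', hi]
    have hγe : γ e + q ≤ β e := by
      have := hγle e
      simp only [g, Function.update_self] at this
      omega
    have hβ'le : β' ≤ β := by
      intro i
      by_cases hi : i = e
      · subst hi; rw [hβ'e]; exact hγe
      · rw [hβ'ne i hi]
        have := hγle i
        simp only [g, Function.update_of_ne hi] at this
        exact this
    have hβ'sum : ∑ i, β' i = d := by
      have h1 := Finset.sum_update_of_mem (Finset.mem_univ e) γ (γ e + q)
      have h2 := Finset.sum_eq_add_sum_sdiff_singleton_of_mem (Finset.mem_univ e) γ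
      have h3 : ∑ i, β' i = ∑ i, Function.update γ e (γ e + q) i :=
        Finset.sum_congr rfl fun i _ => by simp [β']
      rw [h3, h1]
      omega
    have hβ'notle : ¬ β' ≤ α := fun h => by have := h e; rw [hβ'e] at this; omega
    have hβ'E : β' ∈ E := by
      by_contra h
      exact hβ'notle (hstd_d β' hβ'sum h)
    exact hβE (hup hβ'le hβ'E)
  -- (6) `HF(σ−1) ≤ #A_α(σ−1) = k+1`
  have hupper : (std (t - 1)).card ≤ (divSet (⇑α) (t - 1)).card := by
    refine Finset.card_le_card_of_injOn (fun β => ⇑β) (fun β hβ => ?_) (fun β₁ _ β₂ _ h => DFunLike.coe_injective h)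
    obtain ⟨hsum, hβE⟩ := (hmem_std _ β).mp (Finset.mem_coe.mp hβ)
    rw [Finset.mem_coe, mem_divSet]
    exact ⟨hstd_le (t - 1) (by omega) β hsum hβE, hsum⟩
  have hval : (divSet (⇑α) (t - 1)).card = k + 1 := by
    set F : Finset (Fin m) := Finset.univ.filter fun e => α e = d - 2 with hF
    have hαF : (⇑α) = fun e => if e ∈ F then d - 2 else 0 := by
      funext e
      by_cases he : e ∈ F
      · rw [if_pos he]; simpa [hF] using he
      · rw [if_neg he]
        have hne' : α e ≠ d - 2 := by simpa [hF] using he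
        rcases hconc e with h0 | h2 <;> omega
    have hcardF : F.card = k + 1 := by
      have h1 : ∑ e, (⇑α) e = F.card * (d - 2) := by
        rw [hαF, ← Finset.sum_filter, Finset.filter_mem_eq_inter, Finset.univ_inter, Finset.sum_const, smul_eq_mul]
      rw [hαsum'] at h1
      exact (Nat.eq_of_mul_eq_mul_right (by omega) h1).symm
    rw [hαF, card_divSet_indicator, hcardF, ht]
    exact (ciHilbert_replicate_one_and_sub_one k (c := d - 2) (by omega)).2
  -- (7) duality `HF(1) = HF(σ−1)` and the lower bound in degree `1`
  have hsymm := hilbert_annIdeal_symm (σ := Fin m) hℓ (a := 1) (b := t - 1) (by omega)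
  have hlow : k + 1 ≤ finrank K (homogeneousSubmodule (Fin m) K 1) - finrank K (idealDegree (annIdeal ℓ) 1) := by
    have h := ciHilbert_le_hilbert_annIdeal hd ℓ hbox hℓ ht hne (M := 1) (by omega)
    rw [show d - 1 = d - 2 + 1 by omega, (ciHilbert_replicate_one_and_sub_one k (c := d - 2) (by omega)).1] at h
    exact h
  have hup' : finrank K (homogeneousSubmodule (Fin m) K 1) - finrank K (idealDegree (annIdeal ℓ) 1) ≤ k + 1 := by
    rw [hsymm, hHF (t - 1), ← hval]
    exact hupper
  omega

/-- **Corollary (Villaflor Prop. 4.1 for `m = n + 2 = 2k + 2` variables): at least `n/2 + 1` independent linear forms in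
`J^{F,λ} = Ann ℓ`** — `dim (Ann ℓ)_1 = n/2 + 1` — whenever `HF_{Ann ℓ}(d)` attains Movasati's bound and `d ≥ 2 + 6/n`.
[cite: Villaflorloyola2021, Proposition 4.1] -/
theorem finrank_annIdeal_one_of_hilbert_eq {k : ℕ} (hd : 3 ≤ d) (hσ : d + 1 ≤ (k + 1) * (d - 2))
    (ℓ : MvPolynomial (Fin (2 * k + 2)) K →ₗ[K] K)
    (hbox : ∀ s : Fin (2 * k + 2) →₀ ℕ, (∃ e, d - 1 ≤ s e) → ℓ (monomial s 1) = 0)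
    {t : ℕ} (hℓ : ∀ q, ℓ (homogeneousComponent t q) = ℓ q) (ht : t = (k + 1) * (d - 2)) (hne : ℓ ≠ 0)
    (heq : finrank K (homogeneousSubmodule (Fin (2 * k + 2)) K d) - finrank K (idealDegree (annIdeal ℓ) d) =
      (k + d).choose d - (k + 1) ^ 2) :
    finrank K (idealDegree (annIdeal ℓ) 1) = k + 1 := by
  have h := hilbert_annIdeal_one_eq_of_hilbert_eq hd hσ ℓ hbox hℓ ht hne heq
  have hS1 : finrank K (homogeneousSubmodule (Fin (2 * k + 2)) K 1) = 2 * k + 2 := by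
    rw [Literature.RingTheory.HilbertSamuel.finrank_homogeneousSubmodule_fin]
    simp
  haveI : Module.Finite K (homogeneousSubmodule (Fin (2 * k + 2)) K 1) :=
    Module.Finite.iff_fg.mpr (homogeneousSubmodule_fg _ K 1)
  have hle : finrank K (idealDegree (annIdeal ℓ) 1) ≤ finrank K (homogeneousSubmodule (Fin (2 * k + 2)) K 1) :=
    Submodule.finrank_mono inf_le_right
  omega

end LinearForms

/-! ## The second gap (Villaflor, Proposition 3.3, last part; the tangent core of Theorem 1.3) -/

section SecondGap

open Finset Movasati2016

variable {τ : Type*} [Fintype τ] [DecidableEq τ]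

/-- `Σ` over `List.range` is the `Finset.range` sum. [folklore] -/
private theorem sum_map_range (f : ℕ → ℕ) (n : ℕ) :
    ((List.range n).map f).sum = ∑ a ∈ Finset.range n, f a := by
  induction n with
  | zero => simp
  | succ n ih => rw [List.range_succ, List.map_append, List.sum_append, ih, Finset.sum_range_succ]; simp

/-- **Peeling one coordinate off the divisor count**: `#A_κ(M) = Σ_{a ≤ κ_i, a ≤ M} #A_{κ[i ↦ 0]}(M − a)` — the
recursion of the tree's `ciHilbert_cons` for a general exponent vector (fix the exponent `a` of `x_i`).
[cite: Kloosterman2023, §2 eq. (1)] [cite: Villaflorloyola2021, Proposition 3.3] -/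
theorem card_divSet_peel (κ : τ → ℕ) (i : τ) (M : ℕ) :
    (divSet κ M).card = ((List.range (κ i + 1)).map fun a =>
      if a ≤ M then (divSet (Function.update κ i 0) (M - a)).card else 0).sum := by
  classical
  rw [sum_map_range, Finset.card_eq_sum_card_fiberwise (f := fun β : τ → ℕ => β i) (t := Finset.range (κ i + 1))
    (fun β hβ => by
      have h := (mem_divSet.mp (Finset.mem_coe.mp hβ)).1 i
      exact Finset.mem_coe.mpr (Finset.mem_range.mpr (Nat.lt_succ_of_le h)))]
  refine Finset.sum_congr rfl fun a ha => ?_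
  split_ifs with haM
  · -- the fibre `{β ∈ A_κ(M) : β_i = a}` ≅ `A_{κ[i↦0]}(M − a)` via `β ↦ β[i ↦ 0]`
    refine Finset.card_nbij' (fun β => Function.update β i 0) (fun γ => Function.update γ i a)
      (fun β hβ => ?_) (fun γ hγ => ?_) (fun β hβ => ?_) (fun γ hγ => ?_)
    · obtain ⟨hβ, hβi⟩ := Finset.mem_filter.mp (Finset.mem_coe.mp hβ)
      obtain ⟨hle, hsum⟩ := mem_divSet.mp hβ
      rw [Finset.mem_coe, mem_divSet]
      refine ⟨fun e => show Function.update β i 0 e ≤ Function.update κ i 0 e from ?_,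
        show ∑ e, Function.update β i 0 e = M - a from ?_⟩
      · by_cases hei : e = i
        · subst hei; simp
        · rw [Function.update_of_ne hei, Function.update_of_ne hei]; exact hle e
      · have h1 := Finset.sum_update_of_mem (Finset.mem_univ i) β 0
        have h2 := Finset.sum_eq_add_sum_sdiff_singleton_of_mem (Finset.mem_univ i) β
        rw [h1]; omega
    · obtain ⟨hle, hsum⟩ := mem_divSet.mp (Finset.mem_coe.mp hγ)
      rw [Finset.mem_coe, Finset.mem_filter, mem_divSet]
      refine ⟨⟨fun e => show Function.update γ i a e ≤ κ e from ?_, show ∑ e, Function.update γ i a e = M from ?_⟩,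
        by simp⟩
      · by_cases hei : e = i
        · subst hei; simp; exact Nat.lt_succ_iff.mp (Finset.mem_range.mp ha)
        · rw [Function.update_of_ne hei]; have := hle e; rwa [Function.update_of_ne hei] at this
      · have h1 := Finset.sum_update_of_mem (Finset.mem_univ i) γ a
        have h2 := Finset.sum_eq_add_sum_sdiff_singleton_of_mem (Finset.mem_univ i) γ
        have hγi : γ i = 0 := by have := hle i; simp at this; exact this
        rw [h1]; omega
    · obtain ⟨-, hβi⟩ := Finset.mem_filter.mp (Finset.mem_coe.mp hβ)
      funext e
      by_cases hei : e = i
      · subst hei; simp [hβi]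
      · simp [hei]
    · obtain ⟨hle, -⟩ := mem_divSet.mp (Finset.mem_coe.mp hγ)
      have hγi : γ i = 0 := by have := hle i; simp at this; exact this
      funext e
      by_cases hei : e = i
      · subst hei; simp [hγi]
      · simp [hei]
  · -- `a > M`: the fibre is empty
    rw [Finset.card_eq_zero, Finset.filter_eq_empty_iff]
    intro β hβ hβi
    obtain ⟨-, hsum⟩ := mem_divSet.mp hβ
    have := Finset.single_le_sum (fun e _ => Nat.zero_le (β e)) (Finset.mem_univ i)
    omega

/-- The PRE-FINAL shape `c·𝟙_E + (c−1)·e_j + 1·e_i` (`#E = k`; Villaflor's `α = (0,…,0,1,d−3,d−2,…,d−2)`): its count is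
the Hilbert function of the monomial complete intersection of multidegree `(2, c, (c+1)^k)`, i.e. `ciHilbert(2, c, (c+1)^k)`
— for `c = d − 2` the tree's `ciLocusCodim (1^k, 2) d`, the tangent codimension of a complete intersection of type
`(1,…,1,2)` (Villaflor Thm. 1.3: "the ones associated to a complete intersection cycle of type `(1,1,…,1,2)` attain the
minimal possible codimension"). [cite: Villaflorloyola2021, Proposition 3.3, Theorem 1.3] [cite: Kloosterman2023, Prop. 3.2] -/
theorem card_divSet_preFinal (E : Finset τ) {i j : τ} (hij : i ≠ j) (hi : i ∉ E) (hj : j ∉ E) {c : ℕ} (hc : 1 ≤ c)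
    (M : ℕ) :
    (divSet (fun e => if e ∈ E then c else if e = j then c - 1 else if e = i then 1 else 0) M).card =
      Kloosterman2023.ciHilbert (2 :: c :: List.replicate E.card (c + 1)) M := by
  set κ : τ → ℕ := fun e => if e ∈ E then c else if e = j then c - 1 else if e = i then 1 else 0 with hκ
  have hκi : κ i = 1 := by simp [hκ, hi, hij]
  have hκ' : Function.update κ i 0 = fun e => if e ∈ E then c else if e = j then c - 1 else 0 := by
    funext e
    by_cases hei : e = i
    · subst hei; simp [hi, hij]
    · rw [Function.update_of_ne hei]; simp [hκ, hei]
  have hκ'j : Function.update κ i 0 j = c - 1 := by rw [hκ']; simp [hj]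
  have hκ'' : Function.update (Function.update κ i 0) j 0 = fun e => if e ∈ E then c else 0 := by
    rw [hκ']
    funext e
    by_cases hej : e = j
    · subst hej; simp [hj]
    · rw [Function.update_of_ne hej]; simp [hej]
  rw [card_divSet_peel κ i M, hκi, Kloosterman2023.ciHilbert_cons]
  congr 1
  refine List.map_congr_left fun a _ => ?_
  split_ifs with haM
  · rw [card_divSet_peel (Function.update κ i 0) j (M - a), hκ'j, show c - 1 + 1 = c by omega,
      Kloosterman2023.ciHilbert_cons]
    congr 1
    refine List.map_congr_left fun b _ => ?_
    split_ifs with hb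
    · rw [hκ'', card_divSet_indicator]
    · rfl
  · rfl

/-- **Villaflor's Proposition 3.3, last part: the second gap.** A box vector `κ ∈ [0,c]^τ` with `|κ| = (k+1)c` which
is NOT concentrated (some exponent strictly between `0` and `c`) dominates, in every column degree `M`, a pre-final
shape: `#A_κ(M) ≥ #A_{c·𝟙_E + (c−1)e_j + e_i}(M)` for some `#E = k`, `i ≠ j ∉ E` — the concentration process of
Proposition 8 passes through such a shape just before its last shift ("for those `α` not satisfying (al1), we have …
`#S^d_α ≥ C(n/2+d,d) + C(n/2+d−1,d−1) − (3n²/8 + 9n/4 + 2)`, with equality if and only if up to some relabeling of the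
coordinates `α = (0,…,0,1,d−3,d−2,…,d−2)`"). [cite: Villaflorloyola2021, Proposition 3.3] [cite: Movasati2017GMCD, §3.5 Proposition 8] -/
theorem exists_preFinal_card_le {c k : ℕ} {κ : τ → ℕ} (hle : ∀ e, κ e ≤ c) (hsum : ∑ e, κ e = (k + 1) * c)
    (hmid : ∃ e, 0 < κ e ∧ κ e < c) (M : ℕ) :
    ∃ (E : Finset τ) (i j : τ), i ≠ j ∧ i ∉ E ∧ j ∉ E ∧ E.card = k ∧
      (divSet (fun e => if e ∈ E then c else if e = j then c - 1 else if e = i then 1 else 0) M).card ≤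
        (divSet κ M).card := by
  classical
  suffices h : ∀ (μ : ℕ) (κ : τ → ℕ), ∑ e, κ e * (c - κ e) = μ → (∀ e, κ e ≤ c) →
      ∑ e, κ e = (k + 1) * c → (∃ e, 0 < κ e ∧ κ e < c) →
      ∃ (E : Finset τ) (i j : τ), i ≠ j ∧ i ∉ E ∧ j ∉ E ∧ E.card = k ∧
        (divSet (fun e => if e ∈ E then c else if e = j then c - 1 else if e = i then 1 else 0) M).card ≤
          (divSet κ M).card from h _ κ rfl hle hsum hmid
  intro μ
  induction μ using Nat.strong_induction_on with
  | _ μ ih =>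
    intro κ hμ hle hsum hmid
    obtain ⟨i, j, hij, hi, hij', hj⟩ := exists_shift_pair hle hsum hmid
    have hle' : ∀ e, shift κ i j e ≤ c := fun e => by
      by_cases hei : e = i
      · subst hei; rw [shift_apply_left κ hij]; have := hle e; omega
      by_cases hej : e = j
      · subst hej; rw [shift_apply_right]; omega
      rw [shift_apply_of_ne κ hei hej]; exact hle e
    have hsum' : ∑ e, shift κ i j e = (k + 1) * c := by rw [sum_shift κ hij hi, hsum]
    by_cases hmid' : ∃ e, 0 < shift κ i j e ∧ shift κ i j e < c
    · have hlt := potential_shift_lt κ hij hi hij' hj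
      rw [hμ] at hlt
      obtain ⟨E, i', j', h1, h2, h3, h4, h5⟩ := ih _ hlt _ rfl hle' hsum' hmid'
      exact ⟨E, i', j', h1, h2, h3, h4, le_trans h5 (card_divSet_shift_le κ hij hi hij' M)⟩
    · -- `κ` itself is pre-final: `κ_i = 1`, `κ_j = c − 1`, all other exponents `0` or `c`
      push Not at hmid'
      have hκj : κ j = c - 1 := by
        have h1 := hmid' j
        rw [shift_apply_right] at h1
        by_contra hne
        exact absurd (h1 (Nat.succ_pos _)) (by omega)
      have hκi : κ i = 1 := by
        have h1 := hmid' i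
        rw [shift_apply_left κ hij] at h1
        by_contra hne
        have hpos : 0 < κ i - 1 := by omega
        have := h1 hpos
        omega
      set E : Finset τ := Finset.univ.filter fun e => κ e = c with hE
      have hiE : i ∉ E := by simp [hE]; omega
      have hjE : j ∉ E := by simp [hE]; omega
      have hrest : ∀ e, e ≠ i → e ≠ j → κ e = 0 ∨ κ e = c := by
        intro e hei hej
        have h1 := hmid' e
        rw [shift_apply_of_ne κ hei hej] at h1
        by_contra hne
        push Not at hne
        have hpos : 0 < κ e := by omega
        have := h1 hpos
        have := hle e
        omega
      have hκeq : κ = fun e => if e ∈ E then c else if e = j then c - 1 else if e = i then 1 else 0 := by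
        funext e
        by_cases heE : e ∈ E
        · rw [if_pos heE]; simpa [hE] using heE
        rw [if_neg heE]
        by_cases hej : e = j
        · rw [if_pos hej, hej, hκj]
        rw [if_neg hej]
        by_cases hei : e = i
        · rw [if_pos hei, hei, hκi]
        rw [if_neg hei]
        have hne : κ e ≠ c := by simpa [hE] using heE
        rcases hrest e hei hej with h0 | hc' <;> omega
      -- `#E = k` from the total degree
      have hcardE : E.card = k := by
        let g : τ → ℕ := fun e => if e ∈ E then c else 0
        have hg : ∑ e, g e = E.card * c := by
          simp only [g]
          rw [← Finset.sum_filter, Finset.filter_mem_eq_inter, Finset.univ_inter, Finset.sum_const, smul_eq_mul]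
        have hκg : κ = Function.update (Function.update g i 1) j (c - 1) := by
          rw [hκeq]
          funext e
          by_cases hej : e = j
          · rw [hej, Function.update_self, if_neg hjE, if_pos rfl]
          rw [Function.update_of_ne hej]
          by_cases hei : e = i
          · rw [hei, Function.update_self, if_neg hiE, if_neg hij, if_pos rfl]
          rw [Function.update_of_ne hei]
          simp [g, hei, hej]
        have h := sum_update_update g hij 1 (c - 1)
        rw [← hκg, hsum, hg] at h
        have hgi : g i = 0 := by simp [g, hiE]
        have hgj : g j = 0 := by simp [g, hjE]
        rw [hgi, hgj] at h
        have hc1 : 1 ≤ c := by omega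
        have h2 : (k + 1) * c = (E.card + 1) * c := by
          have h3 : (E.card + 1) * c = E.card * c + c := by ring
          rw [h3]; omega
        have := Nat.eq_of_mul_eq_mul_right hc1 h2
        omega
      refine ⟨E, i, j, hij, hiE, hjE, hcardE, ?_⟩
      rw [← hκeq]

/-- **The second gap for the count**, closed form: `κ ∈ [0,c]^τ`, `|κ| = (k+1)c`, not concentrated (`c ≥ 2` then) ⟹
`#A_κ(M) ≥ ciHilbert(2, c, (c+1)^k)(M)` for every `M`. [cite: Villaflorloyola2021, Proposition 3.3]
[cite: Movasati2017GMCD, §3.5 Proposition 8] -/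
theorem ciHilbert_preFinal_le_card_divSet {c k : ℕ} {κ : τ → ℕ} (hle : ∀ e, κ e ≤ c) (hsum : ∑ e, κ e = (k + 1) * c)
    (hmid : ∃ e, 0 < κ e ∧ κ e < c) (M : ℕ) :
    Kloosterman2023.ciHilbert (2 :: c :: List.replicate k (c + 1)) M ≤ (divSet κ M).card := by
  obtain ⟨E, i, j, hij, hi, hj, hE, hcard⟩ := exists_preFinal_card_le hle hsum hmid M
  have hc : 1 ≤ c := by obtain ⟨e, h0, hc⟩ := hmid; omega
  rwa [card_divSet_preFinal E hij hi hj hc M, hE] at hcard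

/-- The closed form of the second bound in the column degree `d` (`k ≥ 1`): `ciHilbert(2, d−2, (d−1)^k)(d)` is the tree's
`ciLocusCodim (1^k, 2) d` — Kloosterman's `h_I(d)` for the complete intersection of type `(1,…,1,2)`, which by the tree's
`Villaflor2022.secondGapBound_eq_ciLocusCodim` equals Villaflor's `C(n/2+d,d) + C(n/2+d−1,d−1) − (3n²/8 + 9n/4 + 2)`
(`n = 2k`, `d ≥ 4`). [cite: Villaflorloyola2021, Theorem 1.3] [cite: Kloosterman2023, Prop. 3.2] -/
theorem ciHilbert_preFinal_eq_ciLocusCodim (k d : ℕ) (hk : 1 ≤ k) :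
    Kloosterman2023.ciHilbert (2 :: (d - 2) :: List.replicate k (d - 1)) d =
      Kloosterman2023.ciLocusCodim (List.replicate k 1 ++ [2]) d := by
  obtain ⟨j, rfl⟩ : ∃ j, k = j + 1 := ⟨k - 1, by omega⟩
  rw [Villaflor2022.ciLocusCodim_ones_two]

variable {K : Type*} [Field K] {m d : ℕ}

/-- **The second gap for the rank of `[p_{i+j}]`** (Villaflor Thm. 1.3 / Prop. 3.3 + Movasati Prop. 7, at the level of
the period matrix): if the LARGEST box exponent `κ ∈ I_{M+N}` (any monomial order) with `p_κ ≠ 0` is NOT concentrated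
— some `0 < κ_e < d − 2` — then `rank [p_{i+j}]_{I_N × I_M} ≥ ciHilbert(2, d−2, (d−1)^k)(M)` (`M + N = (k+1)(d−2)`).
[cite: Villaflorloyola2021, Theorem 1.3, Proposition 3.3] [cite: Movasati2017GMCD, §3.5 Proposition 7] -/
theorem ciHilbert_preFinal_le_rank_periodMatrix (mo : MonomialOrder (Fin m)) {k N M : ℕ}
    (hMN : M + N = (k + 1) * (d - 2)) (p : (Fin m → ℕ) → K)
    (hbox : ∀ i : Fin m → ℕ, (∃ e, d - 1 ≤ i e) → p i = 0)
    {κ : Fin m → ℕ} (hκ : κ ∈ indexSet m d (M + N)) (hpκ : p κ ≠ 0)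
    (hmax : ∀ i ∈ indexSet m d (M + N), okey mo κ < okey mo i → p i = 0)
    (hmid : ∃ e, 0 < κ e ∧ κ e < d - 2) :
    Kloosterman2023.ciHilbert (2 :: (d - 2) :: List.replicate k (d - 1)) M ≤ (periodMatrix m d N M p).rank := by
  obtain ⟨hκlt, hκsum⟩ := mem_indexSet.mp hκ
  have hd : 4 ≤ d := by obtain ⟨e, h0, hc⟩ := hmid; omega
  have h := ciHilbert_preFinal_le_card_divSet (c := d - 2) (k := k) (κ := κ) (fun e => by have := hκlt e; omega)
    (by rw [hκsum, hMN]) hmid M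
  rw [show d - 2 + 1 = d - 1 by omega] at h
  exact le_trans h (card_divSet_le_rank_periodMatrix mo p hbox hκ hpκ hmax)

/-- Census form (`M = d`, `n = 2k ≥ 2`, `n + 2 ≤ (n/2)d`, `d ≥ 4`): a period vector of the Fermat `n`-fold whose largest box
exponent is not concentrated has `rank [p_{i+j}]_{I_{(n/2)d−n−2} × I_d} ≥ ciLocusCodim (1^{n/2}, 2) d`, the tangent
codimension of the complete intersections of type `(1,…,1,2)` — Villaflor's second value
`C(n/2+d,d) + C(n/2+d−1,d−1) − (3n²/8 + 9n/4 + 2)` (`secondGapBound_eq_ciLocusCodim`; `(4,4) ↦ 8`, `(4,6) ↦ 32`).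
[cite: Villaflorloyola2021, Theorem 1.3] [cite: Movasati2017GMCD, §3.5] -/
theorem ciLocusCodim_le_rank_periodMatrix_of_not_concentrated {n : ℕ} (mo : MonomialOrder (Fin (n + 2)))
    (hn : Even n) (hn2 : 2 ≤ n) (hN : n + 2 ≤ n / 2 * d) (p : (Fin (n + 2) → ℕ) → K)
    (hbox : ∀ i : Fin (n + 2) → ℕ, (∃ e, d - 1 ≤ i e) → p i = 0)
    {κ : Fin (n + 2) → ℕ} (hκ : κ ∈ indexSet (n + 2) d ((n / 2 + 1) * (d - 2))) (hpκ : p κ ≠ 0)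
    (hmax : ∀ i ∈ indexSet (n + 2) d ((n / 2 + 1) * (d - 2)), okey mo κ < okey mo i → p i = 0)
    (hmid : ∃ e, 0 < κ e ∧ κ e < d - 2) :
    Kloosterman2023.ciLocusCodim (List.replicate (n / 2) 1 ++ [2]) d ≤
      (periodMatrix (n + 2) d (n / 2 * d - n - 2) d p).rank := by
  have hk : n = 2 * (n / 2) := by obtain ⟨r, hr⟩ := hn; omega
  have hdeg := deg_add_rowDeg hk hN
  rw [← hdeg] at hκ hmax
  rw [← ciHilbert_preFinal_eq_ciLocusCodim (n / 2) d (by omega)]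
  exact ciHilbert_preFinal_le_rank_periodMatrix mo hdeg p hbox hκ hpκ hmax hmid

end SecondGap

/-! ### The second gap for the Gorenstein ideal `J^{F,λ} = Ann ℓ`, via its socle standard monomial (Villaflor's route) -/

section SecondGapIdeal

open MvPolynomial Module Finset Movasati2016 Literature.RingTheory.MvPolynomial
  Literature.AlgebraicGeometry.Kloosterman2025

attribute [local instance] MvPolynomial.gradedAlgebra

variable {K : Type*} [Field K] {m d : ℕ}

open Classical in
/-- **Divisors of a standard monomial are standard** (the leading exponents form an upper set), so for EVERY exponent
`α` which is not a leading exponent of `Ann ℓ` (any monomial order) and every degree `M`: `#A_α(M) ≤ HF_{Ann ℓ}(M)` —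
Villaflor's "`S^k_α ⊆ {x^β ∈ ℂ[x]_k ∖ ⟨LT(J^{F,λ})⟩_k}`", with Macaulay's count (tree `finrank_idealDegree_eq_card`).
[cite: Villaflorloyola2021, Proposition 4.1 (proof), Proposition 3.1, Remark 3.1] -/
theorem card_divSet_le_hilbert_annIdeal_of_notMem (mo : MonomialOrder (Fin m)) (ℓ : MvPolynomial (Fin m) K →ₗ[K] K)
    {t : ℕ} (hℓ : ∀ q, ℓ (homogeneousComponent t q) = ℓ q) {α : Fin m →₀ ℕ}
    (hα : α ∉ leadingExponents mo (annIdeal ℓ)) (M : ℕ) :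
    (divSet (⇑α) M).card ≤ finrank K (homogeneousSubmodule (Fin m) K M) - finrank K (idealDegree (annIdeal ℓ) M) := by
  rw [hilbert_annIdeal_eq_card_standard mo ℓ hℓ M]
  have hup : IsUpperSet (leadingExponents mo (annIdeal ℓ)) := isUpperSet_leadingExponents mo _
  refine Finset.card_le_card_of_injOn (fun j => Finsupp.equivFunOnFinite.symm j) (fun j hj => ?_)
    (fun j₁ _ j₂ _ h => Finsupp.equivFunOnFinite.symm.injective h)
  obtain ⟨hle, hsum⟩ := mem_divSet.mp (Finset.mem_coe.mp hj)
  rw [Finset.mem_coe, Finset.mem_filter, Literature.RingTheory.MvPolynomial.mem_finsuppAntidiag_univ_iff,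
    Finsupp.degree_eq_sum]
  refine ⟨by simpa using hsum, fun hjE => hα (hup (show Finsupp.equivFunOnFinite.symm j ≤ α from fun e => ?_) hjE)⟩
  simpa using hle e

open Classical in
/-- **The socle standard monomial** of `Ann ℓ` (`ℓ ≠ 0` concentrated in degree `t`): there is an exponent `α` of degree
`t` which is not a leading exponent — Villaflor's `x^α ∈ ℂ[x]_σ ∖ ⟨LT(J^{F,λ})⟩_σ` (unique, as `HF(σ) = 1`); if `ℓ` kills
the monomials of `J^F` then `x^α | x_0^{d−2} ⋯ x_{m−1}^{d−2}`. [cite: Villaflorloyola2021, Proposition 4.1, proof of Theorem 1.1] -/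
theorem exists_standard_socle (mo : MonomialOrder (Fin m)) (ℓ : MvPolynomial (Fin m) K →ₗ[K] K)
    (hbox : ∀ s : Fin m →₀ ℕ, (∃ e, d - 1 ≤ s e) → ℓ (monomial s 1) = 0)
    {t : ℕ} (hℓ : ∀ q, ℓ (homogeneousComponent t q) = ℓ q) (hne : ℓ ≠ 0) :
    ∃ α : Fin m →₀ ℕ, (∑ e, α e = t) ∧ α ∉ leadingExponents mo (annIdeal ℓ) ∧ ∀ e, α e ≤ d - 2 := by
  have hsoc := hilbert_annIdeal_top hℓ hne
  rw [hilbert_annIdeal_eq_card_standard mo ℓ hℓ t] at hsoc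
  obtain ⟨α, hα⟩ := Finset.card_eq_one.mp hsoc
  have hαmem : α ∈ ((univ : Finset (Fin m)).finsuppAntidiag t).filter
      fun a => a ∉ leadingExponents mo (annIdeal ℓ) := by
    rw [hα]; exact Finset.mem_singleton_self _
  rw [Finset.mem_filter, Literature.RingTheory.MvPolynomial.mem_finsuppAntidiag_univ_iff, Finsupp.degree_eq_sum] at hαmem
  refine ⟨α, hαmem.1, hαmem.2, fun e => ?_⟩
  by_contra h
  push Not at h
  refine hαmem.2 ⟨monomial α 1, monomial_mem_annIdeal_of_le ℓ hbox ⟨e, by omega⟩,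
    monomial_eq_zero.not.mpr one_ne_zero, ?_⟩
  rw [MonomialOrder.degree_monomial, if_neg one_ne_zero]

/-- **The second gap for `J^{F,λ}` (Villaflor, Theorem 1.3 at the tangent level, via Proposition 3.3):** if the socle
standard monomial `x^α` of `Ann ℓ` (for some monomial order; `ℓ ≠ 0` concentrated in degree `σ = (k+1)(d−2)`, killing
`J^F`) is NOT of the shape `x_{i_1}^{d−2} ⋯ x_{i_{k+1}}^{d−2}` — Villaflor's "(igualdad1) does not hold" — then for every `M`
`HF_{Ann ℓ}(M) ≥ ciHilbert(2, d−2, (d−1)^k)(M)`; at `M = d` this is `ciLocusCodim (1^k, 2) d`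
`= C(n/2+d,d) + C(n/2+d−1,d−1) − (3n²/8 + 9n/4 + 2)` (tree `secondGapBound_eq_ciLocusCodim`, `n = 2k`, `d ≥ 4`).
[cite: Villaflorloyola2021, Theorem 1.3, Proposition 3.3, Proposition 4.1] -/
theorem ciHilbert_preFinal_le_hilbert_annIdeal (mo : MonomialOrder (Fin m)) {k : ℕ} (ℓ : MvPolynomial (Fin m) K →ₗ[K] K)
    (hbox : ∀ s : Fin m →₀ ℕ, (∃ e, d - 1 ≤ s e) → ℓ (monomial s 1) = 0)
    {t : ℕ} (hℓ : ∀ q, ℓ (homogeneousComponent t q) = ℓ q) (ht : t = (k + 1) * (d - 2))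
    {α : Fin m →₀ ℕ} (hαt : ∑ e, α e = t) (hα : α ∉ leadingExponents mo (annIdeal ℓ))
    (hmid : ∃ e, 0 < α e ∧ α e < d - 2) (M : ℕ) :
    Kloosterman2023.ciHilbert (2 :: (d - 2) :: List.replicate k (d - 1)) M ≤
      finrank K (homogeneousSubmodule (Fin m) K M) - finrank K (idealDegree (annIdeal ℓ) M) := by
  have hd : 4 ≤ d := by obtain ⟨e, h0, hc⟩ := hmid; omega
  -- `α` lies in the box: a box-leaving `x^α` would be in `Ann ℓ`, hence a leading exponent
  have hαbox : ∀ e, α e ≤ d - 2 := by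
    intro e
    by_contra h
    push Not at h
    refine hα ⟨monomial α 1, monomial_mem_annIdeal_of_le ℓ hbox ⟨e, by omega⟩,
      monomial_eq_zero.not.mpr one_ne_zero, ?_⟩
    classical
    rw [MonomialOrder.degree_monomial, if_neg one_ne_zero]
  have h := ciHilbert_preFinal_le_card_divSet (c := d - 2) (k := k) (κ := ⇑α) hαbox (by rw [hαt, ht]) hmid M
  rw [show d - 2 + 1 = d - 1 by omega] at h
  exact le_trans h (card_divSet_le_hilbert_annIdeal_of_notMem mo ℓ hℓ hα M)

end SecondGapIdeal

end Literature.AlgebraicGeometry.Movasati2017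

end
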